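/-
Copyright: lit-balaban Phase-2 proof seat p08 (gen 10).  Statement-level skeleton of a published paper; no proof claims beyond what
the kernel checks below.
-/
import Literature.MathematicalPhysics.QuantumFieldTheory.BalabanImbrieJaffe1984to88.BIJ88W1Prime543Bound
import Literature.MathematicalPhysics.QuantumFieldTheory.BalabanImbrieJaffe1984to88.BIJ88W1Prime543CurlDivTorus
import Literature.MathematicalPhysics.QuantumFieldTheory.BalabanImbrieJaffe1984to88.BIJ88W1PrimeCurlLeftFactorTorus

/-!
# `BalabanImbrieJaffe1984to88.BIJ88W1Prime543CurlBoundTorus` — T. Bałaban, J. Imbrie, A. Jaffe, *Effective action and cluster properties of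
the abelian Higgs model*, Commun. Math. Phys. **114** (1988) 257–315 [BalabanImbrieJaffe1988], §5.4 p. 282 [PDF 26]: **THE p. 282 BOUNDS FOR
THE OUTPUT DERIVATIVES `∂w′₁`, `∂*w′₁` OF THE TAIL KERNEL `w′₁ = (𝒟_k − 𝒟_{k,loc})∂*Q^{e*}_k∂□` ON EVERY TORUS OF THE SERIES FOR THE KERNELS
OF RECORD — r16's typed shape `BIJ88Sect5StatementsPart2.Ineq547` INHABITED, NO HYPOTHESIS:
`|(∂w′₁)(p, b′)| ≤ e^{−cρ_k}e^{−c dist_k(p₋, b′₋)}` (`ineq547_dw1P_torus`) and `|(∂*w′₁)(x, b′)| ≤ e^{−cρ_k}e^{−c dist_k(x, b′₋)}`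
(`ineq547_sw1P_torus`)**, for every radius schedule `ρ` beyond a threshold with the printed scale gap `ρ_j ≥ ρ_k + (k−j)θ₀`, and over all
tori with one set of constants.  The printed sentence: *"we find that |(∂w′₁)(p,b′)| ≦ Σ_{j=1}^{k−1}(L^jη)^{−1−(d−2)−1+(d−2)}e^{−cr(e_j)}
e^{−c dist(p,b′)} ≦ e^{−cr(e_k)}e^{−c dist(p,b′)}, and similarly for w′₁, ∂*w′₁"* — the DISPLAYED member is the one proved here; `w′₁` itself
is p02 gen 12's `BIJ88W1Prime543Bound.ineq547_w1P_torus`.  This is the ∂-side ESTIMATE of the p02/p08 split (HOME/STATUS 2026-08-22T02:38Z /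
02:47Z / 03:04Z / 03:22Z): the INSTANCE `Λ(b₁) = (∂^ηH_j(·,b₁))(p)` (resp. `(∂^{η*}H_j(·,b₁))(x)`) of p02's LEFT-ABSTRACTED face bound
`abs_leftFace_le`, with `λ₀ = 2L^{k−j}M(1 + 16C_σ/ρ₀)e^{δ/2}` from this seat's `BIJ88W1PrimeCurlLeftFactorTorus` (the printed extra `(L^jη)^{−1}`),
the exact reduction `dw1P_eq_sum`/`dtT_eq_sum` of this seat's `BIJ88W1Prime543CurlDivTorus`, and p02's resummation `sum_pow_smallness_le`
(growth `(L^{k−j})^d` per scale against the gap).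

statement-level skeleton of published theorems with citation tags; proofs where landed; nothing here is a claim about the Yang–Mills mass gap

PDF held: `paper:balaban1988-cmp114-bij-abelian-higgs-effective-action` (journal page = PDF page + 256); p. 282 [PDF 26] tl.4–9 read this session
on the text layer (display garbled there; quoted from p02's/r16's image reading, as in `BIJ88W1Prime543Torus`).

CITATION HEADER (lean-in-tree rule).  Part of the lit-balaban TYPED SKELETON (HOME `run/shared/lean/pub/lit-balaban/`), Phase-2 proof seat
p08 (gen 10), unit `lit-balaban-p08`; free-target protocol G.5-34(d), TAKING line HOME/STATUS.md 2026-08-22T03:04:57Z.  WHAT IS REPRODUCED =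
SKELETON row **C2.Eq5.4.7** (owner r16 `lit-balaban-r16/ROWS-C2-part2.md`, referee ref-5), the printed bounds for `∂w′₁` and `∂*w′₁`, kind
«model instance for the kernels of record» (r16's flip condition «`Ineq547` instantiated by name for w′₁, ∂w′₁, ∂*w′₁ on the tori»: the two
∂-members).  Decls used BY NAME (nothing restated): p02's `BIJ88W1Prime543Torus` (`w1P`, `tT`, `gT`, `glT`, `boxSingle`, `edgeGeo`,
`sum_abs_curl_boxSingle_mul_le`) and `BIJ88W1Prime543Bound` (`abs_leftFace_le`, `sum_pow_smallness_le`, `distEU_coarse_shift_le`; its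
file-private `smallness_le`/`absorb`/`gap_threshold` are restated here in generalized form as `smallness_weight_le` and the file-private
`absorb_prefactor`/`gap_threshold_eq`); this seat's `BIJ88W1Prime543CurlDivTorus` (`dw1P`, `sw1P`, `dtT`, `stT`, `dtT_eq_sum`, `stT_eq_sum`,
`abs_dw1P_le_sum`, `abs_sw1P_le_sum`) and `BIJ88W1PrimeCurlLeftFactorTorus` (`abs_curl_hlKer_le`, `abs_curl_hKer_sub_hlKer_le`,
`abs_diverg_hlKer_le`, `abs_diverg_hKer_sub_hlKer_le`); r16's `BIJ88Sect5StatementsPart2.Ineq547`; p16's `prop12Printed_levStd_deltaA`, p19's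
`prop12Printed_allTori`, this seat's `exists_HB_allTori_of_prop12Printed`, p09's `cloc_estimates`, r18's `cSide_of_cloc_estimates`.

THE READING (as in the two parent files; `U = 1`, real abelian fields, torus `T_η`, `η = L^{−k}`, standing range `k ≤ m + K`, `d ≥ 2`):
`(∂w′₁)(p, b′)` = `dw1P hd ρ k χ p b′` (output `η`-curl `curl (L^k)` at the fine plaquette `p`), `(∂*w′₁)(x, b′)` = `sw1P hd ρ k χ x b′` (output
`η`-divergence `diverg (L^k)` at the fine site `x`); `dist_k(p, b′) := |p₋ − y_{b′₋}|_∞/L^k` (p09's `distEU` at the plaquette's base point).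

WHAT IS PROVED (0 `sorry`, standard axioms; theorems only):
* §1 `left_consts_le` (`1 + C/(ρ_j/8 − ρ_j/16) ≤ 1 + 16C/ρ₀`), `smallness_weight_le` (the three smallness factors of one scale under the single
  rate `c₁ = min(δ/32, δ_C/4)` with a weight); file-private plumbing (`L^kL^{−j} = L^{k−j}`, exponential weakenings, prefactor absorption).
* §2 THE CURL MEMBER: **`abs_dtT_le`** (`|(∂T_j)(p,p′)|` ≤ p02's face bound with `λ₀ = 2L^{k−j}M(1+16C/ρ₀)e^{δ/2}`), **`abs_sum_dtT_le`**
  (`Σ_{j<k}`, growth `(L^d)^{k−j}` resummed against the gap, `L^de^{−c₁θ} ≤ ½`), **`abs_dw1P_le`** (`≤ 4d·const·e^{a}e^{−c₁ρ_k}e^{−a dist_k(p₋,b′₋)}`),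
  **`ineq547_dw1P_torus`** (NO HYPOTHESIS: `∃ c θ₀ ρ₁ > 0 ∀ k ≤ m + K ∀ ρ` (`ρ_k ≥ ρ₁`, gap `θ₀`) `∀ |χ| ≤ 1`,
  `Ineq547 (TPlaq P 0) (PBond P k) (dw1P hd ρ k χ) (fun p b′ ↦ dist_k(p₋,b′₋)) c (ρ k)`), **`ineq547_dw1P_allTori_of_prop12Printed`**,
  **`ineq547_dw1P_allTori`** (one `(c, θ₀, ρ₁)` for all tori, hypothesis-free).
* §3 THE DIVERGENCE MEMBER: **`abs_stT_le`** (`λ₀ = d·L^{k−j}M(1+16C/ρ₀)e^{δ}`), **`abs_sum_stT_le`**, **`abs_sw1P_le`**, **`ineq547_sw1P_torus`**,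
  **`ineq547_sw1P_allTori_of_prop12Printed`**, **`ineq547_sw1P_allTori`**.
HONEST SCOPE.  (i) The ∂-members only; `w′₁` and `w₁ = w′₁ + H_k□ − H_{k,loc}` are p02's.  (ii) Schedule hypotheses displayed as in p02's file
(threshold `ρ_k ≥ ρ₁` absorbing the O(1) prefactor; scale gap with `L^de^{−c₁θ₀} = ½` — one power more than p02's `L^{d−1}` because of the
extra `L^{k−j}` of the left factor; print: the growth of `r(e_j)`, (2.2)–(2.3), p08 g4's `rLen_scale_gap`).  (iii) Face count crude as in p02's
file (G-C2-22); constants explicit, not optimal.  (iv) `U = 1`, real abelian fields, torus, standing range.  (v) No `def`, no new named fact;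
NOT summit progress.  Unit `lit-balaban-p08` (literature-prover-lit-balaban-p08-g10-0), 2026-08-22.
-/

open scoped BigOperators RealInnerProductSpace

namespace Literature.MathematicalPhysics.QuantumFieldTheory.BalabanImbrieJaffe1984to88.BIJ88W1Prime543CurlBoundTorus

open Balaban1983to89 hiding Site Plaq
open Balaban1983to89.LatticeFieldCalculus
open BIJ88Ineq217Ineq722Torus (ofLp_HkE_single exists_bound_of_ineq722 torusKernelData_gradH_nonneg)
open BIJ85Eq721MinimizerKernel (torusKernelData_gradH)
open BIJ85AxialPropagator411 (toE)
open BIJ85Prop521Torus BIJ85Prop522Torus BIJ85Sigma422Eta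
open BIJ85Sect7Statements BIJ85Ineq722Torus
open BIJ85Ineq722DeltaA (deltaAData ineq722_deltaA_of_prop12Printed)
open BIJ85Ineq722ProofPart2 (settingOf)
open BIJ85CellAverages
open BIJ85Eq224Base0 (torusEdgeCellsTo card_edgeBTo)
open BIJ88ClocFactorsTorus (Cmat distB distB_apply)
open BIJ88ClocEstimatesTorus (Cloc cloc_estimates)
open BIJ88Cutoffs21 (cutoff cutoffProfile)
open BIJ88Sect2Statements (applyK)
open BIJ88Sect5StatementsPart2 (Ineq547)
open BIJ85Prop12PerTower (prop12Printed_levStd_deltaA)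
open BIJ85Prop12AllTori (prop12Printed_allTori)
open BIJ88Decay223CkAllTori (exists_HB_allTori_of_prop12Printed)
open BIJ88CurlyDkLocTorus
open BIJ88CurlyDkLocGradTerm (exists_cutoffProfile_lipschitz)
open BIJ88CurlyDkLocCloseTorus (cSide_of_cloc_estimates)
open BIJ88W1Prime543Torus
open BIJ88W1Prime543Bound (abs_leftFace_le sum_pow_smallness_le distEU_coarse_shift_le)
open BIJ88W1Prime543CurlDivTorus (dw1P sw1P dtT stT dtT_eq_sum stT_eq_sum abs_dw1P_le_sum abs_sw1P_le_sum)
open BIJ88W1PrimeCurlLeftFactorTorus (abs_curl_hlKer_le abs_curl_hKer_sub_hlKer_le abs_diverg_hlKer_le abs_diverg_hKer_sub_hlKer_le)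
-- inside this namespace the bare `Site`/`Plaq` are the `ℤ^d` carriers of the QFT root; the torus ones are renamed:
open Balaban1983to89 renaming Site → TSite, Plaq → TPlaq

noncomputable section

variable {P : Params}

/-! ## §1  Small algebra: the left-factor constant along the schedule -/

/-- `0 < L^n`. [folklore] -/
private theorem cast_pow_L_pos' (n : ℕ) : (0 : ℝ) < (P.L : ℝ) ^ n := pow_pos P.cast_L_pos n

/-- `L^k·(L^j)^{−1} = L^{k−j}` for `j ≤ k`. [folklore] -/
private theorem pow_k_mul_inv_pow_j {j k : ℕ} (hjk : j ≤ k) : (P.L : ℝ) ^ k * ((P.L : ℝ) ^ j)⁻¹ = (P.L : ℝ) ^ (k - j) :=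
  (pow_sub₀ _ P.cast_L_pos.ne' hjk).symm

/-- `ℓ·ℓ^{d−1} = ℓ^d` for `d ≥ 2`. [folklore] -/
private theorem mul_pow_dm1 (hd : 2 ≤ P.d) (ℓ : ℝ) : ℓ * ℓ ^ (P.d - 1) = ℓ ^ P.d := by
  rw [← pow_succ']; congr 1; omega

/-- `(L^{k−j})^{d} = (L^{d})^{k−j}`. [folklore] -/
private theorem pow_pow_comm_d (k j : ℕ) : ((P.L : ℝ) ^ (k - j)) ^ P.d = ((P.L : ℝ) ^ P.d) ^ (k - j) := by
  rw [← pow_mul, ← pow_mul, mul_comm]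

/-- along the schedule the slope denominator is `ρ_j/16 ≥ ρ₀/16`: `1 + C/(ρ_j/8 − ρ_j/16) ≤ 1 + 16C/ρ₀` (`C ≥ 0`, `0 < ρ₀ ≤ ρ_j`).
[cite: BalabanImbrieJaffe1988, (2.5) p.260] -/
theorem left_consts_le {C ρ₀ ρj : ℝ} (hC0 : 0 ≤ C) (hρ₀ : 0 < ρ₀) (hr : ρ₀ ≤ ρj) :
    1 + C / (ρj / 8 - ρj / 16) ≤ 1 + 16 * C / ρ₀ := by
  rw [show ρj / 8 - ρj / 16 = ρj / 16 by ring, div_div_eq_mul_div, show C * 16 = 16 * C by ring]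
  have h : 16 * C / ρj ≤ 16 * C / ρ₀ := div_le_div_of_nonneg_left (mul_nonneg (by norm_num) hC0) hρ₀ hr
  linarith

/-- `e^{−δD} ≤ e^{δ/2}·e^{−(δ/2)D}` for `δ, D ≥ 0`. [folklore] -/
private theorem exp_weaken_half {δ D : ℝ} (hδ : 0 ≤ δ) (hD : 0 ≤ D) :
    Real.exp (-(δ * D)) ≤ Real.exp (δ / 2) * Real.exp (-(δ / 2 * D)) := by
  rw [← Real.exp_add]; exact Real.exp_le_exp.2 (by nlinarith)

/-- `e^{δ}e^{−δD} ≤ e^{δ}·e^{−(δ/2)D}` for `δ, D ≥ 0`. [folklore] -/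
private theorem exp_weaken_half' {δ D : ℝ} (hδ : 0 ≤ δ) (hD : 0 ≤ D) :
    Real.exp δ * Real.exp (-(δ * D)) ≤ Real.exp δ * Real.exp (-(δ / 2 * D)) :=
  mul_le_mul_of_nonneg_left (Real.exp_le_exp.2 (by nlinarith)) (Real.exp_pos _).le

/-- monotonicity of the left-factor constant in its three slots. [folklore] -/
private theorem upgrade {n Lk Lji M A A' E E' : ℝ} (hn : 0 ≤ n) (hLk : 0 ≤ Lk) (hLji : 0 ≤ Lji) (hM : 0 ≤ M) (hA : 0 ≤ A) (hAA : A ≤ A')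
    (hE : 0 ≤ E) (hEE : E ≤ E') :
    n * Lk * (Lji * (M * A) * E) ≤ n * Lk * (Lji * (M * A') * E') := by
  have h1 : Lji * (M * A) ≤ Lji * (M * A') := mul_le_mul_of_nonneg_left (mul_le_mul_of_nonneg_left hAA hM) hLji
  have h2 : Lji * (M * A) * E ≤ Lji * (M * A') * E' :=
    mul_le_mul h1 hEE hE (mul_nonneg hLji (mul_nonneg hM (hA.trans hAA)))
  exact mul_le_mul_of_nonneg_left h2 (mul_nonneg hn hLk)

/-- the three smallness factors of one scale under a single rate, with an arbitrary weight `w ≥ 0` on the third: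
`e^{−(δ/2)(ρ/16)} + e^{−(δ_C/4)ρ} + w·e^{δ/2}e^{−(δ/2)(ρ/16)} ≤ (2 + w·e^{δ/2})e^{−c₁ρ}`, `c₁ = min(δ/32, δ_C/4)`, `ρ ≥ 0` (p02's `smallness_le`
is the instance `w = 1 + 16C_σ/ρ₀`; restated here because p02's lemma is file-private). [cite: BalabanImbrieJaffe1988, (5.4.3) p.282] -/
theorem smallness_weight_le {δ δC w ρ : ℝ} (hw : 0 ≤ w) (hρ : 0 ≤ ρ) :
    Real.exp (-(δ / 2 * (ρ / 16))) + Real.exp (-(δC / 4 * ρ)) + w * Real.exp (δ / 2) * Real.exp (-(δ / 2 * (ρ / 16))) ≤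
      (2 + w * Real.exp (δ / 2)) * Real.exp (-(min (δ / 32) (δC / 4) * ρ)) := by
  have h1 : Real.exp (-(δ / 2 * (ρ / 16))) ≤ Real.exp (-(min (δ / 32) (δC / 4) * ρ)) :=
    Real.exp_le_exp.2 (by nlinarith [min_le_left (δ / 32) (δC / 4)])
  have h2 : Real.exp (-(δC / 4 * ρ)) ≤ Real.exp (-(min (δ / 32) (δC / 4) * ρ)) :=
    Real.exp_le_exp.2 (by nlinarith [min_le_right (δ / 32) (δC / 4)])
  have h3 : w * Real.exp (δ / 2) * Real.exp (-(δ / 2 * (ρ / 16))) ≤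
      w * Real.exp (δ / 2) * Real.exp (-(min (δ / 32) (δC / 4) * ρ)) :=
    mul_le_mul_of_nonneg_left h1 (by positivity)
  nlinarith

/-- absorbing a prefactor into the smallness (p02's `absorb`, file-private there, restated with the rate written `min(a, c₁/2)`):
`Ae^{−c₁ρ}e^{−aD} ≤ e^{−c′ρ}e^{−c′D}`, `c′ = min(a, c₁/2)`, once `ρ ≥ 2log(max(A,1))/c₁` (`ρ, D ≥ 0`). [folklore] -/
private theorem absorb_prefactor {A c₁ a ρ D : ℝ} (hc₁ : 0 < c₁) (hD : 0 ≤ D) (hρ : 2 * Real.log (max A 1) / c₁ ≤ ρ) (hρ0 : 0 ≤ ρ) :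
    A * Real.exp (-(c₁ * ρ)) * Real.exp (-(a * D)) ≤ Real.exp (-(min a (c₁ / 2) * ρ)) * Real.exp (-(min a (c₁ / 2) * D)) := by
  have hmax : 0 < max A 1 := lt_of_lt_of_le one_pos (le_max_right _ _)
  have hlog : Real.log (max A 1) ≤ c₁ / 2 * ρ := by
    rw [div_le_iff₀ hc₁] at hρ; linarith
  have h1 : A ≤ Real.exp (c₁ / 2 * ρ) :=
    (le_max_left A 1).trans (by rw [← Real.exp_log hmax]; exact Real.exp_le_exp.2 hlog)
  have h2 : A * Real.exp (-(c₁ * ρ)) ≤ Real.exp (-(min a (c₁ / 2) * ρ)) := by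
    calc A * Real.exp (-(c₁ * ρ)) ≤ Real.exp (c₁ / 2 * ρ) * Real.exp (-(c₁ * ρ)) :=
          mul_le_mul_of_nonneg_right h1 (Real.exp_pos _).le
      _ = Real.exp (-(c₁ / 2 * ρ)) := by rw [← Real.exp_add]; ring_nf
      _ ≤ _ := Real.exp_le_exp.2 (by nlinarith [min_le_right a (c₁ / 2)])
  have h3 : Real.exp (-(a * D)) ≤ Real.exp (-(min a (c₁ / 2) * D)) := Real.exp_le_exp.2 (by nlinarith [min_le_left a (c₁ / 2)])
  calc A * Real.exp (-(c₁ * ρ)) * Real.exp (-(a * D)) ≤ Real.exp (-(min a (c₁ / 2) * ρ)) * Real.exp (-(a * D)) :=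
        mul_le_mul_of_nonneg_right h2 (Real.exp_pos _).le
    _ ≤ _ := mul_le_mul_of_nonneg_left h3 (Real.exp_pos _).le

/-- the scale-gap threshold as an EQUALITY: with `θ₀ = log(2Λ)/c₁`, `Λe^{−c₁θ₀} = ½` (`Λ, c₁ > 0`; p02's `gap_threshold` is the `≤`,
file-private there). [folklore] -/
private theorem gap_threshold_eq {Λ c₁ : ℝ} (hΛ : 0 < Λ) (hc₁ : 0 < c₁) : Λ * Real.exp (-(c₁ * (Real.log (2 * Λ) / c₁))) = 1 / 2 := by
  have h2 : 0 < 2 * Λ := by positivity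
  rw [mul_div_cancel₀ _ hc₁.ne', Real.exp_neg, Real.exp_log h2]
  field_simp

/-! ## §2  The curl member `∂w′₁` -/

section Curl

/-- **THE SCALE-`j` TERM `(∂T_j)(p, p′)`** — the instance `Λ(b₁) = (∂^ηH_j(·,b₁))(p)`, `Λ_l(b₁) = (∂^ηH_{j,loc}(·,b₁))(p)`, anchor `p₋`,
`λ₀ = 2L^{k−j}M(1 + 16C_σ/ρ₀)e^{δ/2}`, of p02's `abs_leftFace_le`: `|(∂T_j)(p,p′)| ≤ S(ρ_j)·2λ₀MM_C(L^{k−j})^{d−1}d²e^{a/2}K(a)²·e^{a/2}·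
e^{−a·dist_k(p₋,p′₋)}` — the printed per-scale count with its extra `(L^jη)^{−1}`. [cite: BalabanImbrieJaffe1988, (5.4.3) p.282] -/
theorem abs_dtT_le (hd : 2 ≤ P.d) {k j : ℕ} (hk : k ≤ P.m + P.K) (hj : j ≤ P.m + P.K) (hjk : j ≤ k) {a : ℝ} (ha : 0 < a)
    {δ M δC MC : ℝ} (hδ : 0 < δ) (hδC : 0 < δC) (hM : 0 ≤ M) (hMC : 0 ≤ MC)
    (hH : ∀ (μ ν : Fin P.d) (x : TSite P 0) (y : TSite P j),
      |(torusRep P j (deltaAData hj a)).H (x, μ) (y, ν)| ≤ M * Real.exp (-(δ * distEU P j x y)))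
    (hB : ∀ (μ ν : Fin P.d) (x : TSite P 0) (y : TSite P j),
      ‖fun lam : Fin P.d => (P.L : ℝ) ^ j *
          ((torusRep P j (deltaAData hj a)).H (x.shift lam, μ) (y, ν) - (torusRep P j (deltaAData hj a)).H (x, μ) (y, ν))‖ ≤
        M * Real.exp (-(δ * distEU P j x y)))
    {C : ℝ} (hC0 : 0 ≤ C) (hCζ : ∀ (R₁ R₀ : ℝ), R₁ < R₀ → ∀ t s : ℝ,
      |cutoffProfile R₁ R₀ t - cutoffProfile R₁ R₀ s| ≤ C / (R₀ - R₁) * |t - s|)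
    (ρ : ℕ → ℝ) {ρ₀ : ℝ} (hρ₀ : 0 < ρ₀) (hr : ρ₀ ≤ ρ j)
    (hCm : ∀ b₁ b₂ : PBond P j, |Cmat P j b₁ b₂| ≤ MC * Real.exp (-(δC * (supDist b₁.src b₂.src : ℝ))))
    (hCl : ∀ b₁ b₂ : PBond P j, |Cloc P j (ρ j / 4) b₁ b₂| ≤ MC * Real.exp (-(δC * (supDist b₁.src b₂.src : ℝ))))
    (hCd : ∀ b₁ b₂ : PBond P j, |Cloc P j (ρ j / 4) b₁ b₂ - Cmat P j b₁ b₂| ≤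
      MC * Real.exp (-(δC / 4 * ρ j)) * Real.exp (-(δC * (supDist b₁.src b₂.src : ℝ))))
    (p : TPlaq P 0) (p' : TPlaq P k) :
    |dtT hd ρ k j p p'| ≤
      (Real.exp (-(δ / 2 * (ρ j / 16))) + Real.exp (-(δC / 4 * ρ j)) +
          (1 + 16 * C / ρ₀) * Real.exp (δ / 2) * Real.exp (-(δ / 2 * (ρ j / 16)))) *
        (2 * (2 * (P.L : ℝ) ^ (k - j) * (M * (1 + 16 * C / ρ₀)) * Real.exp (δ / 2)) * M * MC *
          ((P.L : ℝ) ^ (k - j)) ^ (P.d - 1) * ((P.d : ℝ) ^ 2 *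
          (Real.exp (min (δ / 2) δC / 2 / 2) * ((2 * (1 + P.d / (min (δ / 2) δC / 2))) ^ P.d) ^ 2))) *
        (Real.exp (min (δ / 2) δC / 2 / 2) * Real.exp (-(min (δ / 2) δC / 2 * distEU P k p.src p'.src))) := by
  have hρj : 0 < ρ j := lt_of_lt_of_le hρ₀ hr
  have hR : ρ j / 16 < ρ j / 8 := by linarith
  have hw : 0 < (P.eta k) ^ P.d := pow_pos (eta_pos P k) _
  have hc : (P.L : ℝ) ^ k ≠ 0 := (cast_pow_L_pos' k).ne'
  have hLk : 0 ≤ (P.L : ℝ) ^ k := (cast_pow_L_pos' k).le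
  have hLji : 0 ≤ ((P.L : ℝ) ^ j)⁻¹ := inv_nonneg.2 (cast_pow_L_pos' j).le
  have hCζ' := hCζ (ρ j / 16) (ρ j / 8) hR
  have hA : 0 ≤ 1 + C / (ρ j / 8 - ρ j / 16) := by
    have : 0 < ρ j / 8 - ρ j / 16 := by linarith
    positivity
  have hAA : 1 + C / (ρ j / 8 - ρ j / 16) ≤ 1 + 16 * C / ρ₀ := left_consts_le hC0 hρ₀ hr
  have hD0 : ∀ b₁ : PBond P j, 0 ≤ distEU P j p.src b₁.src := fun b₁ => div_nonneg (Nat.cast_nonneg _) (cast_pow_L_pos' j).le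
  set lam0 : ℝ := 2 * (P.L : ℝ) ^ (k - j) * (M * (1 + 16 * C / ρ₀)) * Real.exp (δ / 2) with hlam0
  have hlam0_0 : 0 ≤ lam0 := by positivity
  have hkj : (P.L : ℝ) ^ k * ((P.L : ℝ) ^ j)⁻¹ = (P.L : ℝ) ^ (k - j) := pow_k_mul_inv_pow_j hjk
  -- the localized column
  have hΛl : ∀ b₁ : PBond P j,
      |curl ((P.L : ℝ) ^ k) (fun b : PBond P 0 =>
          hlKer (P := P) ((P.eta k) ^ P.d) ((P.L : ℝ) ^ k) (ρ j / 16) (ρ j / 8) j b b₁) p| ≤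
        lam0 * Real.exp (-(δ / 2 * distEU P j p.src b₁.src)) := by
    intro b₁
    refine (abs_curl_hlKer_le hj hw hc ha hH hB hC0 hR hCζ' k p b₁).trans ?_
    refine (upgrade zero_le_two hLk hLji hM hA hAA (Real.exp_pos _).le (exp_weaken_half hδ.le (hD0 b₁))).trans (le_of_eq ?_)
    rw [hlam0, ← hkj]; ring
  -- the differenced column
  have hΛd : ∀ b₁ : PBond P j,
      |curl ((P.L : ℝ) ^ k) (fun b : PBond P 0 => hKer (P := P) ((P.eta k) ^ P.d) ((P.L : ℝ) ^ k) j b b₁) p -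
          curl ((P.L : ℝ) ^ k) (fun b : PBond P 0 =>
            hlKer (P := P) ((P.eta k) ^ P.d) ((P.L : ℝ) ^ k) (ρ j / 16) (ρ j / 8) j b b₁) p| ≤
        lam0 * Real.exp (-(δ / 2 * (ρ j / 16))) * Real.exp (-(δ / 2 * distEU P j p.src b₁.src)) := by
    intro b₁
    rw [← curl_sub]
    refine (abs_curl_hKer_sub_hlKer_le hj hw hc ha hδ.le hH hB hC0 hR hCζ' k p b₁).trans ?_
    have hA2 : 0 ≤ (1 + C / (ρ j / 8 - ρ j / 16)) * Real.exp (δ / 2) * Real.exp (-(δ / 2 * (ρ j / 16))) := by positivity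
    have hAA2 : (1 + C / (ρ j / 8 - ρ j / 16)) * Real.exp (δ / 2) * Real.exp (-(δ / 2 * (ρ j / 16))) ≤
        (1 + 16 * C / ρ₀) * Real.exp (δ / 2) * Real.exp (-(δ / 2 * (ρ j / 16))) :=
      mul_le_mul_of_nonneg_right (mul_le_mul_of_nonneg_right hAA (Real.exp_pos _).le) (Real.exp_pos _).le
    have h := upgrade zero_le_two hLk hLji hM hA2 hAA2 (Real.exp_pos (-(δ / 2 * distEU P j p.src b₁.src))).le le_rfl
    refine (le_of_eq ?_).trans (h.trans (le_of_eq ?_))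
    · ring
    · rw [hlam0, ← hkj]; ring
  rw [dtT_eq_sum]
  exact abs_leftFace_le hd hk hj hjk ha hδ hδC hM hMC hH hB hC0 hCζ ρ hρ₀ hr hCm hCl hCd hlam0_0 hΛl hΛd p'

/-- **THE SCALE SUM `Σ_{j<k}(∂T_j)(p, p′)`** (hypotheses as in p02's `abs_sum_tT_le` with the scale gap against `L^{d}`: `L^de^{−c₁θ} ≤ ½`,
`c₁ = min(δ/32, δ_C/4)`): `|Σ_{j<k}(∂T_j)(p,p′)| ≤ (2 + (1+16C_σ/ρ₀)e^{δ/2})·2λ₀′MM_Cd²e^{a/2}K(a)²·e^{a/2}·e^{−c₁ρ_k}·e^{−a dist_k(p₋,p′₋)}`,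
`λ₀′ = 2M(1+16C_σ/ρ₀)e^{δ/2}` — print's «≦ Σ_j (L^jη)^{−2}e^{−cr(e_j)}e^{−c dist} ≦ e^{−cr(e_k)}e^{−c dist}» for `∂w′₁`.
[cite: BalabanImbrieJaffe1988, (5.4.3) p.282] -/
theorem abs_sum_dtT_le (hd : 2 ≤ P.d) {k : ℕ} (hk : k ≤ P.m + P.K) {a : ℝ} (ha : 0 < a)
    {δ M δC MC : ℝ} (hδ : 0 < δ) (hδC : 0 < δC) (hM : 0 ≤ M) (hMC : 0 ≤ MC)
    (hH : ∀ (j : ℕ) (hj : j ≤ P.m + P.K), j < k → ∀ (μ ν : Fin P.d) (x : TSite P 0) (y : TSite P j),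
      |(torusRep P j (deltaAData hj a)).H (x, μ) (y, ν)| ≤ M * Real.exp (-(δ * distEU P j x y)))
    (hB : ∀ (j : ℕ) (hj : j ≤ P.m + P.K), j < k → ∀ (μ ν : Fin P.d) (x : TSite P 0) (y : TSite P j),
      ‖fun lam : Fin P.d => (P.L : ℝ) ^ j *
          ((torusRep P j (deltaAData hj a)).H (x.shift lam, μ) (y, ν) - (torusRep P j (deltaAData hj a)).H (x, μ) (y, ν))‖ ≤
        M * Real.exp (-(δ * distEU P j x y)))
    {C : ℝ} (hC0 : 0 ≤ C) (hCζ : ∀ (R₁ R₀ : ℝ), R₁ < R₀ → ∀ t s : ℝ,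
      |cutoffProfile R₁ R₀ t - cutoffProfile R₁ R₀ s| ≤ C / (R₀ - R₁) * |t - s|)
    (ρ : ℕ → ℝ) {ρ₀ θ : ℝ} (hρ₀ : 0 < ρ₀) (hρ : ∀ j < k, ρ₀ ≤ ρ j)
    (hgap : ∀ j < k, ρ k + ((k - j : ℕ) : ℝ) * θ ≤ ρ j)
    (hθ : (P.L : ℝ) ^ P.d * Real.exp (-(min (δ / 32) (δC / 4) * θ)) ≤ 1 / 2)
    (hCm : ∀ j < k, ∀ b₁ b₂ : PBond P j, |Cmat P j b₁ b₂| ≤ MC * Real.exp (-(δC * (supDist b₁.src b₂.src : ℝ))))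
    (hCl : ∀ j < k, ∀ b₁ b₂ : PBond P j, |Cloc P j (ρ j / 4) b₁ b₂| ≤ MC * Real.exp (-(δC * (supDist b₁.src b₂.src : ℝ))))
    (hCd : ∀ j < k, ∀ b₁ b₂ : PBond P j, |Cloc P j (ρ j / 4) b₁ b₂ - Cmat P j b₁ b₂| ≤
      MC * Real.exp (-(δC / 4 * ρ j)) * Real.exp (-(δC * (supDist b₁.src b₂.src : ℝ))))
    (p : TPlaq P 0) (p' : TPlaq P k) :
    |∑ j ∈ Finset.range k, dtT hd ρ k j p p'| ≤
      (2 + (1 + 16 * C / ρ₀) * Real.exp (δ / 2)) *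
        (2 * (2 * (M * (1 + 16 * C / ρ₀)) * Real.exp (δ / 2)) * M * MC *
          ((P.d : ℝ) ^ 2 * (Real.exp (min (δ / 2) δC / 2 / 2) * ((2 * (1 + P.d / (min (δ / 2) δC / 2))) ^ P.d) ^ 2))) *
        Real.exp (min (δ / 2) δC / 2 / 2) * Real.exp (-(min (δ / 32) (δC / 4) * ρ k)) *
        Real.exp (-(min (δ / 2) δC / 2 * distEU P k p.src p'.src)) := by
  set c₁ : ℝ := min (δ / 32) (δC / 4) with hc₁
  have hc₁0 : 0 ≤ c₁ := (lt_min (by positivity) (by positivity)).le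
  set S₀ : ℝ := 2 + (1 + 16 * C / ρ₀) * Real.exp (δ / 2) with hS₀
  set Z : ℝ := 2 * (2 * (M * (1 + 16 * C / ρ₀)) * Real.exp (δ / 2)) * M * MC *
    ((P.d : ℝ) ^ 2 * (Real.exp (min (δ / 2) δC / 2 / 2) * ((2 * (1 + P.d / (min (δ / 2) δC / 2))) ^ P.d) ^ 2)) with hZ
  set E' : ℝ := Real.exp (min (δ / 2) δC / 2 / 2) * Real.exp (-(min (δ / 2) δC / 2 * distEU P k p.src p'.src)) with hE'
  have hZ0 : 0 ≤ Z := by positivity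
  have hE0 : 0 ≤ E' := by positivity
  have hC' : 0 ≤ 1 + 16 * C / ρ₀ := by positivity
  have hj' : ∀ j < k, j ≤ P.m + P.K := fun j hj => by omega
  have hscale : ∀ j ∈ Finset.range k, |dtT hd ρ k j p p'| ≤
      (S₀ * Z * E') * (((P.L : ℝ) ^ P.d) ^ (k - j) * Real.exp (-(c₁ * ρ j))) := by
    intro j hjm
    have hjk := Finset.mem_range.1 hjm
    have h := abs_dtT_le hd hk (hj' j hjk) hjk.le ha hδ hδC hM hMC (hH j (hj' j hjk) hjk) (hB j (hj' j hjk) hjk) hC0 hCζ ρ hρ₀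
      (hρ j hjk) (hCm j hjk) (hCl j hjk) (hCd j hjk) p p'
    refine h.trans ?_
    have hsm := smallness_weight_le (δ := δ) (δC := δC) hC' ((hρ₀.le).trans (hρ j hjk))
    rw [← hc₁, ← hS₀] at hsm
    rw [← hE']
    have hsplitZ : 2 * (2 * (P.L : ℝ) ^ (k - j) * (M * (1 + 16 * C / ρ₀)) * Real.exp (δ / 2)) * M * MC *
          ((P.L : ℝ) ^ (k - j)) ^ (P.d - 1) * ((P.d : ℝ) ^ 2 *
          (Real.exp (min (δ / 2) δC / 2 / 2) * ((2 * (1 + P.d / (min (δ / 2) δC / 2))) ^ P.d) ^ 2)) =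
        Z * ((P.L : ℝ) ^ P.d) ^ (k - j) := by
      rw [hZ, ← pow_pow_comm_d, ← mul_pow_dm1 hd ((P.L : ℝ) ^ (k - j))]; ring
    rw [hsplitZ]
    have hY : 0 ≤ Z * ((P.L : ℝ) ^ P.d) ^ (k - j) * E' := by positivity
    calc _ ≤ (S₀ * Real.exp (-(c₁ * ρ j))) * (Z * ((P.L : ℝ) ^ P.d) ^ (k - j)) * E' :=
          mul_le_mul_of_nonneg_right (mul_le_mul_of_nonneg_right hsm (by positivity)) hE0
      _ = _ := by ring
  calc |∑ j ∈ Finset.range k, dtT hd ρ k j p p'| ≤ ∑ j ∈ Finset.range k, |dtT hd ρ k j p p'| := Finset.abs_sum_le_sum_abs _ _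
    _ ≤ ∑ j ∈ Finset.range k, (S₀ * Z * E') * (((P.L : ℝ) ^ P.d) ^ (k - j) * Real.exp (-(c₁ * ρ j))) :=
        Finset.sum_le_sum hscale
    _ = (S₀ * Z * E') * ∑ j ∈ Finset.range k, ((P.L : ℝ) ^ P.d) ^ (k - j) * Real.exp (-(c₁ * ρ j)) := by
        rw [Finset.mul_sum]
    _ ≤ (S₀ * Z * E') * Real.exp (-(c₁ * ρ k)) :=
        mul_le_mul_of_nonneg_left (sum_pow_smallness_le (pow_pos P.cast_L_pos _).le hc₁0 hθ hgap) (by positivity)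
    _ = _ := by rw [hE']; ring

/-- **THE BOUND FOR `(∂w′₁)(p, b′)` ON THE TORUS** (hypotheses of `abs_sum_dtT_le`, a cube function `|χ| ≤ 1`): for every fine plaquette `p`
and unit bond `b′`, `|(∂w′₁)(p, b′)| ≤ 4d·(2 + (1+16C_σ/ρ₀)e^{δ/2})·2λ₀′MM_Cd²e^{a/2}K(a)²·e^{a/2}·e^{a}·e^{−c₁ρ_k}·e^{−a·dist_k(p₋, b′₋)}` —
the reduction `dw1P_eq_sum`, the scale sum at each of the `≤ 4d` unit plaquettes through `b′` (p02's `sum_abs_curl_boxSingle_mul_le`,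
`distEU_coarse_shift_le`). [cite: BalabanImbrieJaffe1988, (5.4.3) p.282] -/
theorem abs_dw1P_le (hd : 2 ≤ P.d) {k : ℕ} (hk : k ≤ P.m + P.K) {a : ℝ} (ha : 0 < a)
    {δ M δC MC : ℝ} (hδ : 0 < δ) (hδC : 0 < δC) (hM : 0 ≤ M) (hMC : 0 ≤ MC)
    (hH : ∀ (j : ℕ) (hj : j ≤ P.m + P.K), j < k → ∀ (μ ν : Fin P.d) (x : TSite P 0) (y : TSite P j),
      |(torusRep P j (deltaAData hj a)).H (x, μ) (y, ν)| ≤ M * Real.exp (-(δ * distEU P j x y)))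
    (hB : ∀ (j : ℕ) (hj : j ≤ P.m + P.K), j < k → ∀ (μ ν : Fin P.d) (x : TSite P 0) (y : TSite P j),
      ‖fun lam : Fin P.d => (P.L : ℝ) ^ j *
          ((torusRep P j (deltaAData hj a)).H (x.shift lam, μ) (y, ν) - (torusRep P j (deltaAData hj a)).H (x, μ) (y, ν))‖ ≤
        M * Real.exp (-(δ * distEU P j x y)))
    {C : ℝ} (hC0 : 0 ≤ C) (hCζ : ∀ (R₁ R₀ : ℝ), R₁ < R₀ → ∀ t s : ℝ,
      |cutoffProfile R₁ R₀ t - cutoffProfile R₁ R₀ s| ≤ C / (R₀ - R₁) * |t - s|)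
    (ρ : ℕ → ℝ) {ρ₀ θ : ℝ} (hρ₀ : 0 < ρ₀) (hρ : ∀ j < k, ρ₀ ≤ ρ j)
    (hgap : ∀ j < k, ρ k + ((k - j : ℕ) : ℝ) * θ ≤ ρ j)
    (hθ : (P.L : ℝ) ^ P.d * Real.exp (-(min (δ / 32) (δC / 4) * θ)) ≤ 1 / 2)
    (hCm : ∀ j < k, ∀ b₁ b₂ : PBond P j, |Cmat P j b₁ b₂| ≤ MC * Real.exp (-(δC * (supDist b₁.src b₂.src : ℝ))))
    (hCl : ∀ j < k, ∀ b₁ b₂ : PBond P j, |Cloc P j (ρ j / 4) b₁ b₂| ≤ MC * Real.exp (-(δC * (supDist b₁.src b₂.src : ℝ))))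
    (hCd : ∀ j < k, ∀ b₁ b₂ : PBond P j, |Cloc P j (ρ j / 4) b₁ b₂ - Cmat P j b₁ b₂| ≤
      MC * Real.exp (-(δC / 4 * ρ j)) * Real.exp (-(δC * (supDist b₁.src b₂.src : ℝ))))
    (χ : PBond P k → ℝ) (hχ : ∀ b', |χ b'| ≤ 1) (p : TPlaq P 0) (b' : PBond P k) :
    |dw1P hd ρ k χ p b'| ≤
      4 * P.d * ((2 + (1 + 16 * C / ρ₀) * Real.exp (δ / 2)) *
        (2 * (2 * (M * (1 + 16 * C / ρ₀)) * Real.exp (δ / 2)) * M * MC *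
          ((P.d : ℝ) ^ 2 * (Real.exp (min (δ / 2) δC / 2 / 2) * ((2 * (1 + P.d / (min (δ / 2) δC / 2))) ^ P.d) ^ 2))) *
        Real.exp (min (δ / 2) δC / 2 / 2) * Real.exp (min (δ / 2) δC / 2)) * Real.exp (-(min (δ / 32) (δC / 4) * ρ k)) *
        Real.exp (-(min (δ / 2) δC / 2 * distEU P k p.src b'.src)) := by
  set aa : ℝ := min (δ / 2) δC / 2 with haa
  have haa0 : 0 < aa := half_pos (lt_min (half_pos hδ) hδC)
  set Y : ℝ := (2 + (1 + 16 * C / ρ₀) * Real.exp (δ / 2)) *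
      (2 * (2 * (M * (1 + 16 * C / ρ₀)) * Real.exp (δ / 2)) * M * MC * ((P.d : ℝ) ^ 2 * (Real.exp (aa / 2) * ((2 * (1 + P.d / aa)) ^ P.d) ^ 2))) *
      Real.exp (aa / 2) * Real.exp (-(min (δ / 32) (δC / 4) * ρ k)) with hY
  have hY0 : 0 ≤ Y := by positivity
  clear_value Y
  have hsum : ∀ p' : TPlaq P k, |∑ j ∈ Finset.range k, dtT hd ρ k j p p'| ≤ Y * Real.exp (-(aa * distEU P k p.src p'.src)) := by
    intro p'
    have h := abs_sum_dtT_le hd hk ha hδ hδC hM hMC hH hB hC0 hCζ ρ hρ₀ hρ hgap hθ hCm hCl hCd p p'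
    rw [← haa] at h
    refine h.trans (le_of_eq ?_)
    rw [hY]
  have hnear : ∀ p' : TPlaq P k, distEU P k p.src b'.src ≤ distEU P k p.src p'.src + 1 →
      |∑ j ∈ Finset.range k, dtT hd ρ k j p p'| ≤ Y * Real.exp aa * Real.exp (-(aa * distEU P k p.src b'.src)) := by
    intro p' hp'
    refine (hsum p').trans ?_
    have hexp : Real.exp (-(aa * distEU P k p.src p'.src)) ≤ Real.exp aa * Real.exp (-(aa * distEU P k p.src b'.src)) := by
      rw [← Real.exp_add]; exact Real.exp_le_exp.2 (by nlinarith)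
    calc Y * Real.exp (-(aa * distEU P k p.src p'.src)) ≤ Y * (Real.exp aa * Real.exp (-(aa * distEU P k p.src b'.src))) :=
        mul_le_mul_of_nonneg_left hexp hY0
      _ = _ := (mul_assoc _ _ _).symm
  have hW1 : ∀ p' : TPlaq P k, (⟨p'.src, p'.μ⟩ : PBond P k) = b' →
      |∑ j ∈ Finset.range k, dtT hd ρ k j p p'| ≤ Y * Real.exp aa * Real.exp (-(aa * distEU P k p.src b'.src)) := by
    intro p' h; refine hnear p' ?_; rw [← h]; linarith
  have hW2 : ∀ p' : TPlaq P k, (⟨p'.src.shift p'.μ, p'.ν⟩ : PBond P k) = b' →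
      |∑ j ∈ Finset.range k, dtT hd ρ k j p p'| ≤ Y * Real.exp aa * Real.exp (-(aa * distEU P k p.src b'.src)) := by
    intro p' h; refine hnear p' ?_; rw [← h]; exact distEU_coarse_shift_le hk p.src p'.src p'.μ
  have hW3 : ∀ p' : TPlaq P k, (⟨p'.src.shift p'.ν, p'.μ⟩ : PBond P k) = b' →
      |∑ j ∈ Finset.range k, dtT hd ρ k j p p'| ≤ Y * Real.exp aa * Real.exp (-(aa * distEU P k p.src b'.src)) := by
    intro p' h; refine hnear p' ?_; rw [← h]; exact distEU_coarse_shift_le hk p.src p'.src p'.ν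
  have hW4 : ∀ p' : TPlaq P k, (⟨p'.src, p'.ν⟩ : PBond P k) = b' →
      |∑ j ∈ Finset.range k, dtT hd ρ k j p p'| ≤ Y * Real.exp aa * Real.exp (-(aa * distEU P k p.src b'.src)) := by
    intro p' h; refine hnear p' ?_; rw [← h]; linarith
  have hmain := sum_abs_curl_boxSingle_mul_le χ b' (w := fun p' => |∑ j ∈ Finset.range k, dtT hd ρ k j p p'|)
    (fun p' => abs_nonneg _) (by positivity) hW1 hW2 hW3 hW4
  refine (abs_dw1P_le_sum hd ρ χ p b').trans (hmain.trans ?_)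
  have hχ1 := hχ b'
  have hpos : 0 ≤ 4 * (P.d : ℝ) * (Y * Real.exp aa * Real.exp (-(aa * distEU P k p.src b'.src))) := by positivity
  calc 4 * P.d * |χ b'| * (Y * Real.exp aa * Real.exp (-(aa * distEU P k p.src b'.src)))
      ≤ 4 * P.d * 1 * (Y * Real.exp aa * Real.exp (-(aa * distEU P k p.src b'.src))) := by nlinarith
    _ = _ := by rw [hY]; ring

/-- **(5.4.7)-SHAPE FOR `∂w′₁` ON EVERY TORUS OF THE SERIES, FOR THE KERNELS OF RECORD — NO HYPOTHESIS** (`d ≥ 2`; per-tower [6I] Prop. 1.2 is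
p16's theorem, p09's `cloc_estimates`, this seat's profile slope; `a = 1`): there are `c, θ₀, ρ₁ > 0` such that for every `k ≤ m + K`, every
radius schedule with `ρ_k ≥ ρ₁` and the scale gap `ρ_j ≥ ρ_k + (k−j)θ₀` (`j < k`), and every cube function `|χ| ≤ 1`:
`Ineq547 (T_η-plaquettes) (T₁^{(k)}-bonds) ∂w′₁ dist_k c ρ_k`, i.e. **`|(∂w′₁)(p, b′)| ≤ e^{−cρ_k}e^{−c·dist_k(p₋, b′₋)}` for all `p, b′`** —
the printed `|(∂w′₁)(p,b′)| ≦ e^{−cr(e_k)}e^{−c dist(p,b′)}`. [cite: BalabanImbrieJaffe1988, (5.4.3) p.282] -/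
theorem ineq547_dw1P_torus (hd : 2 ≤ P.d) :
    ∃ c θ₀ ρ₁ : ℝ, 0 < c ∧ 0 < θ₀ ∧ 0 < ρ₁ ∧ ∀ (k : ℕ) (_ : k ≤ P.m + P.K) (ρ : ℕ → ℝ),
      ρ₁ ≤ ρ k → (∀ j < k, ρ k + ((k - j : ℕ) : ℝ) * θ₀ ≤ ρ j) →
      ∀ (χ : PBond P k → ℝ), (∀ b', |χ b'| ≤ 1) →
        Ineq547 (TPlaq P 0) (PBond P k) (dw1P hd ρ k χ) (fun p b' => distEU P k p.src b'.src) c (ρ k) := by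
  classical
  have h722 := ineq722_deltaA_of_prop12Printed (levStd P) levStd_le one_pos (fun _ => PUnit) (fun _ _ _ => 0) (fun _ _ _ _ _ => 0)
    (fun _ _ _ => 0) (prop12Printed_levStd_deltaA P 1)
  obtain ⟨δ, M, hδ, hM, hBall⟩ := exists_bound_of_ineq722 levStd_le h722
  obtain ⟨MC, δ₀, hMC, hδ₀, HC⟩ := cloc_estimates P.d P.L hd
  obtain ⟨C, hC0, hCζ⟩ := exists_cutoffProfile_lipschitz
  have hcov : ∀ j ≤ P.m + P.K, ∃ i, levStd P i = j := fun j hj => ⟨j, min_eq_left hj⟩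
  have hδC : 0 < δ₀ / 2 := half_pos hδ₀
  set MC' : ℝ := MC * (Real.exp (4 * δ₀ * P.L) * (1 + P.L) ^ 2) with hMC'
  have hMC'0 : 0 ≤ MC' := by positivity
  set c₁ : ℝ := min (δ / 32) (δ₀ / 2 / 4) with hc₁
  have hc₁0 : 0 < c₁ := lt_min (by positivity) (by positivity)
  set aa : ℝ := min (δ / 2) (δ₀ / 2) / 2 with haa
  have haa0 : 0 < aa := half_pos (lt_min (half_pos hδ) hδC)
  set Λ : ℝ := (P.L : ℝ) ^ P.d with hΛ
  have hΛ0 : 0 < Λ := pow_pos P.cast_L_pos _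
  set θ₀ : ℝ := Real.log (2 * Λ) / c₁ with hθ₀
  have hθ₀0 : 0 < θ₀ := by
    refine div_pos (Real.log_pos ?_) hc₁0
    have : (1 : ℝ) ≤ Λ := one_le_pow₀ (by exact_mod_cast P.L_pos)
    linarith
  set A : ℝ := 4 * P.d * ((2 + (1 + 16 * C / 1) * Real.exp (δ / 2)) *
      (2 * (2 * (M * (1 + 16 * C / 1)) * Real.exp (δ / 2)) * M * MC' * ((P.d : ℝ) ^ 2 * (Real.exp (aa / 2) * ((2 * (1 + P.d / aa)) ^ P.d) ^ 2))) *
      Real.exp (aa / 2) * Real.exp aa) with hA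
  set ρ₁ : ℝ := max 1 (2 * Real.log (max A 1) / c₁) with hρ₁
  have hρ₁1 : 1 ≤ ρ₁ := le_max_left _ _
  refine ⟨min aa (c₁ / 2), θ₀, ρ₁, lt_min haa0 (half_pos hc₁0), hθ₀0, lt_of_lt_of_le one_pos hρ₁1,
    fun k hk ρ hρk hgap χ hχ => ?_⟩
  have hH : ∀ (j : ℕ) (hj : j ≤ P.m + P.K), j < k → ∀ (μ ν : Fin P.d) (x : TSite P 0) (y : TSite P j),
      |(torusRep P j (deltaAData hj 1)).H (x, μ) (y, ν)| ≤ M * Real.exp (-(δ * distEU P j x y)) := by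
    intro j hj _ μ ν x y
    obtain ⟨i, hi⟩ := hcov j hj
    subst hi
    exact (le_add_of_nonneg_right torusKernelData_gradH_nonneg).trans (hBall i μ ν x y)
  have hB : ∀ (j : ℕ) (hj : j ≤ P.m + P.K), j < k → ∀ (μ ν : Fin P.d) (x : TSite P 0) (y : TSite P j),
      ‖fun lam : Fin P.d => (P.L : ℝ) ^ j *
          ((torusRep P j (deltaAData hj 1)).H (x.shift lam, μ) (y, ν) - (torusRep P j (deltaAData hj 1)).H (x, μ) (y, ν))‖ ≤
        M * Real.exp (-(δ * distEU P j x y)) := by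
    intro j hj _ μ ν x y
    obtain ⟨i, hi⟩ := hcov j hj
    subst hi
    have h := hBall i μ ν x y
    rw [torusKernelData_gradH] at h
    exact (le_add_of_nonneg_left (abs_nonneg _)).trans h
  have hC : ∀ j < k, (∀ b₁ b₂ : PBond P j, |Cmat P j b₁ b₂| ≤ MC' * Real.exp (-(δ₀ / 2 * (supDist b₁.src b₂.src : ℝ)))) ∧
      (∀ b₁ b₂ : PBond P j, |Cloc P j (ρ j / 4) b₁ b₂| ≤ MC' * Real.exp (-(δ₀ / 2 * (supDist b₁.src b₂.src : ℝ)))) ∧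
      (∀ b₁ b₂ : PBond P j, |Cloc P j (ρ j / 4) b₁ b₂ - Cmat P j b₁ b₂| ≤
        MC' * Real.exp (-(δ₀ / 2 / 4 * ρ j)) * Real.exp (-(δ₀ / 2 * (supDist b₁.src b₂.src : ℝ)))) :=
    fun j hjk => cSide_of_cloc_estimates hMC hδ₀ (fun R b b' => HC P rfl rfl j inferInstance (by omega) R b b') (ρ j)
  have hρk0 : 0 ≤ ρ k := by linarith
  have hρ : ∀ j < k, (1 : ℝ) ≤ ρ j := by
    intro j hj
    have h := hgap j hj
    have : 0 ≤ ((k - j : ℕ) : ℝ) * θ₀ := mul_nonneg (Nat.cast_nonneg _) hθ₀0.le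
    linarith
  have hθ : Λ * Real.exp (-(c₁ * θ₀)) ≤ 1 / 2 := (gap_threshold_eq hΛ0 hc₁0).le
  intro p b'
  have hw := abs_dw1P_le hd hk one_pos hδ hδC hM hMC'0 hH hB hC0 hCζ ρ one_pos hρ hgap hθ
    (fun j hjk => (hC j hjk).1) (fun j hjk => (hC j hjk).2.1) (fun j hjk => (hC j hjk).2.2) χ hχ p b'
  have hD : 0 ≤ distEU P k p.src b'.src := div_nonneg (Nat.cast_nonneg _) (cast_pow_L_pos' k).le
  have hρA : 2 * Real.log (max A 1) / c₁ ≤ ρ k := (le_max_right _ _).trans hρk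
  exact hw.trans (absorb_prefactor hc₁0 hD hρA hρk0)

/-- **(5.4.7)-SHAPE FOR `∂w′₁` OVER ALL TORI FROM [6I] PROP. 1.2 BY ITS TREE NAME** (`2 ≤ d`, `L` odd `> 1`): ONE `(c, θ₀, ρ₁)` for EVERY torus
(`P.d = d`, `P.L = L`), every `k ≤ m + K`, every admissible schedule and cube function (this seat's all-tori sup + gradient lemma
`exists_HB_allTori_of_prop12Printed`, p09's all-tori `cloc_estimates`). [cite: BalabanImbrieJaffe1988, (5.4.3) p.282] -/
theorem ineq547_dw1P_allTori_of_prop12Printed {d L : ℕ} (hd : 2 ≤ d) (hL : Odd L ∧ 1 < L) {a : ℝ} (ha : 0 < a)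
    (h12 : B5.Prop12Printed (fun i : {x : Params × ℕ // x.1.d = d ∧ x.1.L = L ∧ 1 ≤ x.2 ∧ x.2 ≤ x.1.m + x.1.K} =>
      settingOf (torusRep i.1.1 i.1.2 (deltaAData i.2.2.2.2 a)) i.1.2)) :
    ∃ c θ₀ ρ₁ : ℝ, 0 < c ∧ 0 < θ₀ ∧ 0 < ρ₁ ∧ ∀ (P : Params) (hPd : P.d = d) (_ : P.L = L) (k : ℕ) (_ : k ≤ P.m + P.K) (ρ : ℕ → ℝ),
      ρ₁ ≤ ρ k → (∀ j < k, ρ k + ((k - j : ℕ) : ℝ) * θ₀ ≤ ρ j) →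
      ∀ (χ : PBond P k → ℝ), (∀ b', |χ b'| ≤ 1) →
        Ineq547 (TPlaq P 0) (PBond P k) (dw1P (hPd ▸ hd) ρ k χ) (fun p b' => distEU P k p.src b'.src) c (ρ k) := by
  classical
  obtain ⟨δ, M, hδ, hM1, hHB⟩ := exists_HB_allTori_of_prop12Printed (le_trans one_le_two hd) hL ha h12
  obtain ⟨MC, δ₀, hMC, hδ₀, HC⟩ := cloc_estimates d L hd
  obtain ⟨C, hC0, hCζ⟩ := exists_cutoffProfile_lipschitz
  have hδC : 0 < δ₀ / 2 := half_pos hδ₀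
  have hM : 0 ≤ M := zero_le_one.trans hM1
  have hL0 : (0 : ℝ) < L := by have := hL.2; exact_mod_cast (by omega : 0 < L)
  set MC' : ℝ := MC * (Real.exp (4 * δ₀ * L) * (1 + L) ^ 2) with hMC'
  have hMC'0 : 0 ≤ MC' := by positivity
  set c₁ : ℝ := min (δ / 32) (δ₀ / 2 / 4) with hc₁
  have hc₁0 : 0 < c₁ := lt_min (by positivity) (by positivity)
  set aa : ℝ := min (δ / 2) (δ₀ / 2) / 2 with haa
  have haa0 : 0 < aa := half_pos (lt_min (half_pos hδ) hδC)
  set Λ : ℝ := (L : ℝ) ^ d with hΛ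
  have hΛ0 : 0 < Λ := pow_pos hL0 _
  set θ₀ : ℝ := Real.log (2 * Λ) / c₁ with hθ₀
  have hθ₀0 : 0 < θ₀ := by
    refine div_pos (Real.log_pos ?_) hc₁0
    have : (1 : ℝ) ≤ Λ := one_le_pow₀ (by have := hL.2; exact_mod_cast (by omega : 1 ≤ L))
    linarith
  set A : ℝ := 4 * d * ((2 + (1 + 16 * C / 1) * Real.exp (δ / 2)) *
      (2 * (2 * (M * (1 + 16 * C / 1)) * Real.exp (δ / 2)) * M * MC' * ((d : ℝ) ^ 2 * (Real.exp (aa / 2) * ((2 * (1 + d / aa)) ^ d) ^ 2))) *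
      Real.exp (aa / 2) * Real.exp aa) with hA
  set ρ₁ : ℝ := max 1 (2 * Real.log (max A 1) / c₁) with hρ₁
  have hρ₁1 : 1 ≤ ρ₁ := le_max_left _ _
  refine ⟨min aa (c₁ / 2), θ₀, ρ₁, lt_min haa0 (half_pos hc₁0), hθ₀0, lt_of_lt_of_le one_pos hρ₁1,
    fun P hPd hPL k hk ρ hρk hgap χ hχ => ?_⟩
  subst hPd; subst hPL
  have hH : ∀ (j : ℕ) (hj : j ≤ P.m + P.K), j < k → ∀ (μ ν : Fin P.d) (x : TSite P 0) (y : TSite P j),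
      |(torusRep P j (deltaAData hj a)).H (x, μ) (y, ν)| ≤ M * Real.exp (-(δ * distEU P j x y)) :=
    fun j hj _ μ ν x y => (hHB P rfl rfl j hj μ ν x y).1
  have hB : ∀ (j : ℕ) (hj : j ≤ P.m + P.K), j < k → ∀ (μ ν : Fin P.d) (x : TSite P 0) (y : TSite P j),
      ‖fun lam : Fin P.d => (P.L : ℝ) ^ j *
          ((torusRep P j (deltaAData hj a)).H (x.shift lam, μ) (y, ν) - (torusRep P j (deltaAData hj a)).H (x, μ) (y, ν))‖ ≤
        M * Real.exp (-(δ * distEU P j x y)) :=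
    fun j hj _ μ ν x y => (hHB P rfl rfl j hj μ ν x y).2
  have hC : ∀ j < k, (∀ b₁ b₂ : PBond P j, |Cmat P j b₁ b₂| ≤ MC' * Real.exp (-(δ₀ / 2 * (supDist b₁.src b₂.src : ℝ)))) ∧
      (∀ b₁ b₂ : PBond P j, |Cloc P j (ρ j / 4) b₁ b₂| ≤ MC' * Real.exp (-(δ₀ / 2 * (supDist b₁.src b₂.src : ℝ)))) ∧
      (∀ b₁ b₂ : PBond P j, |Cloc P j (ρ j / 4) b₁ b₂ - Cmat P j b₁ b₂| ≤
        MC' * Real.exp (-(δ₀ / 2 / 4 * ρ j)) * Real.exp (-(δ₀ / 2 * (supDist b₁.src b₂.src : ℝ)))) :=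
    fun j hjk => cSide_of_cloc_estimates hMC hδ₀ (fun R b b' => HC P rfl rfl j inferInstance (by omega) R b b') (ρ j)
  have hρk0 : 0 ≤ ρ k := by linarith
  have hρ : ∀ j < k, (1 : ℝ) ≤ ρ j := by
    intro j hj
    have h := hgap j hj
    have : 0 ≤ ((k - j : ℕ) : ℝ) * θ₀ := mul_nonneg (Nat.cast_nonneg _) hθ₀0.le
    linarith
  have hθ : Λ * Real.exp (-(c₁ * θ₀)) ≤ 1 / 2 := (gap_threshold_eq hΛ0 hc₁0).le
  intro p b'
  have hw := abs_dw1P_le hd hk ha hδ hδC hM hMC'0 hH hB hC0 hCζ ρ one_pos hρ hgap hθ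
    (fun j hjk => (hC j hjk).1) (fun j hjk => (hC j hjk).2.1) (fun j hjk => (hC j hjk).2.2) χ hχ p b'
  have hD : 0 ≤ distEU P k p.src b'.src := div_nonneg (Nat.cast_nonneg _) (cast_pow_L_pos' k).le
  have hρA : 2 * Real.log (max A 1) / c₁ ≤ ρ k := (le_max_right _ _).trans hρk
  exact hw.trans (absorb_prefactor hc₁0 hD hρA hρk0)

/-- **(5.4.7)-SHAPE FOR `∂w′₁` OVER ALL TORI, HYPOTHESIS-FREE** (`2 ≤ d`, `L` odd `> 1`): ONE `(c, θ₀, ρ₁)` for every torus, every `k ≤ m + K`,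
every admissible schedule and cube function — with [6I] Prop. 1.2 supplied by p19's `prop12Printed_allTori` (at `a = 1`).
[cite: BalabanImbrieJaffe1988, (5.4.3) p.282] -/
theorem ineq547_dw1P_allTori {d L : ℕ} (hd : 2 ≤ d) (hL : Odd L ∧ 1 < L) :
    ∃ c θ₀ ρ₁ : ℝ, 0 < c ∧ 0 < θ₀ ∧ 0 < ρ₁ ∧ ∀ (P : Params) (hPd : P.d = d) (_ : P.L = L) (k : ℕ) (_ : k ≤ P.m + P.K) (ρ : ℕ → ℝ),
      ρ₁ ≤ ρ k → (∀ j < k, ρ k + ((k - j : ℕ) : ℝ) * θ₀ ≤ ρ j) →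
      ∀ (χ : PBond P k → ℝ), (∀ b', |χ b'| ≤ 1) →
        Ineq547 (TPlaq P 0) (PBond P k) (dw1P (hPd ▸ hd) ρ k χ) (fun p b' => distEU P k p.src b'.src) c (ρ k) :=
  ineq547_dw1P_allTori_of_prop12Printed hd hL one_pos (prop12Printed_allTori d L one_pos)

end Curl

/-! ## §3  The divergence member `∂*w′₁` -/

section Div

/-- **THE SCALE-`j` TERM `(∂*T_j)(x, p′)`** — the instance `Λ(b₁) = (∂^{η*}H_j(·,b₁))(x)`, `Λ_l(b₁) = (∂^{η*}H_{j,loc}(·,b₁))(x)`, anchor `x`,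
`λ₀ = d·L^{k−j}M(1 + 16C_σ/ρ₀)e^{δ}`, of p02's `abs_leftFace_le`: `|(∂*T_j)(x,p′)| ≤ S(ρ_j)·2λ₀MM_C(L^{k−j})^{d−1}d²e^{a/2}K(a)²·e^{a/2}·
e^{−a·dist_k(x,p′₋)}` («similarly for … ∂*w′₁»; `d` backward differences, anchor moved back one `η`-step). [cite: BalabanImbrieJaffe1988, (5.4.3) p.282] -/
theorem abs_stT_le (hd : 2 ≤ P.d) {k j : ℕ} (hk : k ≤ P.m + P.K) (hj : j ≤ P.m + P.K) (hjk : j ≤ k) {a : ℝ} (ha : 0 < a)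
    {δ M δC MC : ℝ} (hδ : 0 < δ) (hδC : 0 < δC) (hM : 0 ≤ M) (hMC : 0 ≤ MC)
    (hH : ∀ (μ ν : Fin P.d) (x : TSite P 0) (y : TSite P j),
      |(torusRep P j (deltaAData hj a)).H (x, μ) (y, ν)| ≤ M * Real.exp (-(δ * distEU P j x y)))
    (hB : ∀ (μ ν : Fin P.d) (x : TSite P 0) (y : TSite P j),
      ‖fun lam : Fin P.d => (P.L : ℝ) ^ j *
          ((torusRep P j (deltaAData hj a)).H (x.shift lam, μ) (y, ν) - (torusRep P j (deltaAData hj a)).H (x, μ) (y, ν))‖ ≤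
        M * Real.exp (-(δ * distEU P j x y)))
    {C : ℝ} (hC0 : 0 ≤ C) (hCζ : ∀ (R₁ R₀ : ℝ), R₁ < R₀ → ∀ t s : ℝ,
      |cutoffProfile R₁ R₀ t - cutoffProfile R₁ R₀ s| ≤ C / (R₀ - R₁) * |t - s|)
    (ρ : ℕ → ℝ) {ρ₀ : ℝ} (hρ₀ : 0 < ρ₀) (hr : ρ₀ ≤ ρ j)
    (hCm : ∀ b₁ b₂ : PBond P j, |Cmat P j b₁ b₂| ≤ MC * Real.exp (-(δC * (supDist b₁.src b₂.src : ℝ))))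
    (hCl : ∀ b₁ b₂ : PBond P j, |Cloc P j (ρ j / 4) b₁ b₂| ≤ MC * Real.exp (-(δC * (supDist b₁.src b₂.src : ℝ))))
    (hCd : ∀ b₁ b₂ : PBond P j, |Cloc P j (ρ j / 4) b₁ b₂ - Cmat P j b₁ b₂| ≤
      MC * Real.exp (-(δC / 4 * ρ j)) * Real.exp (-(δC * (supDist b₁.src b₂.src : ℝ))))
    (x : TSite P 0) (p' : TPlaq P k) :
    |stT hd ρ k j x p'| ≤
      (Real.exp (-(δ / 2 * (ρ j / 16))) + Real.exp (-(δC / 4 * ρ j)) +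
          (1 + 16 * C / ρ₀) * Real.exp (δ / 2) * Real.exp (-(δ / 2 * (ρ j / 16)))) *
        (2 * ((P.d : ℝ) * (P.L : ℝ) ^ (k - j) * (M * (1 + 16 * C / ρ₀)) * Real.exp δ) * M * MC *
          ((P.L : ℝ) ^ (k - j)) ^ (P.d - 1) * ((P.d : ℝ) ^ 2 *
          (Real.exp (min (δ / 2) δC / 2 / 2) * ((2 * (1 + P.d / (min (δ / 2) δC / 2))) ^ P.d) ^ 2))) *
        (Real.exp (min (δ / 2) δC / 2 / 2) * Real.exp (-(min (δ / 2) δC / 2 * distEU P k x p'.src))) := by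
  have hρj : 0 < ρ j := lt_of_lt_of_le hρ₀ hr
  have hR : ρ j / 16 < ρ j / 8 := by linarith
  have hw : 0 < (P.eta k) ^ P.d := pow_pos (eta_pos P k) _
  have hc : (P.L : ℝ) ^ k ≠ 0 := (cast_pow_L_pos' k).ne'
  have hLk : 0 ≤ (P.L : ℝ) ^ k := (cast_pow_L_pos' k).le
  have hLji : 0 ≤ ((P.L : ℝ) ^ j)⁻¹ := inv_nonneg.2 (cast_pow_L_pos' j).le
  have hCζ' := hCζ (ρ j / 16) (ρ j / 8) hR
  have hA : 0 ≤ 1 + C / (ρ j / 8 - ρ j / 16) := by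
    have : 0 < ρ j / 8 - ρ j / 16 := by linarith
    positivity
  have hAA : 1 + C / (ρ j / 8 - ρ j / 16) ≤ 1 + 16 * C / ρ₀ := left_consts_le hC0 hρ₀ hr
  have hD0 : ∀ b₁ : PBond P j, 0 ≤ distEU P j x b₁.src := fun b₁ => div_nonneg (Nat.cast_nonneg _) (cast_pow_L_pos' j).le
  set lam0 : ℝ := (P.d : ℝ) * (P.L : ℝ) ^ (k - j) * (M * (1 + 16 * C / ρ₀)) * Real.exp δ with hlam0
  have hlam0_0 : 0 ≤ lam0 := by positivity
  have hkj : (P.L : ℝ) ^ k * ((P.L : ℝ) ^ j)⁻¹ = (P.L : ℝ) ^ (k - j) := pow_k_mul_inv_pow_j hjk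
  -- the localized column
  have hΛl : ∀ b₁ : PBond P j,
      |diverg ((P.L : ℝ) ^ k) (fun b : PBond P 0 =>
          hlKer (P := P) ((P.eta k) ^ P.d) ((P.L : ℝ) ^ k) (ρ j / 16) (ρ j / 8) j b b₁) x| ≤
        lam0 * Real.exp (-(δ / 2 * distEU P j x b₁.src)) := by
    intro b₁
    refine (abs_diverg_hlKer_le hj hw hc ha hδ.le hH hB hC0 hR hCζ' k x b₁).trans ?_
    refine (upgrade (Nat.cast_nonneg P.d) hLk hLji hM hA hAA (by positivity) (exp_weaken_half' hδ.le (hD0 b₁))).trans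
      (le_of_eq ?_)
    rw [hlam0, ← hkj]; ring
  -- the differenced column
  have hΛd : ∀ b₁ : PBond P j,
      |diverg ((P.L : ℝ) ^ k) (fun b : PBond P 0 => hKer (P := P) ((P.eta k) ^ P.d) ((P.L : ℝ) ^ k) j b b₁) x -
          diverg ((P.L : ℝ) ^ k) (fun b : PBond P 0 =>
            hlKer (P := P) ((P.eta k) ^ P.d) ((P.L : ℝ) ^ k) (ρ j / 16) (ρ j / 8) j b b₁) x| ≤
        lam0 * Real.exp (-(δ / 2 * (ρ j / 16))) * Real.exp (-(δ / 2 * distEU P j x b₁.src)) := by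
    intro b₁
    rw [show diverg ((P.L : ℝ) ^ k) (fun b : PBond P 0 => hKer (P := P) ((P.eta k) ^ P.d) ((P.L : ℝ) ^ k) j b b₁) x -
        diverg ((P.L : ℝ) ^ k) (fun b : PBond P 0 =>
          hlKer (P := P) ((P.eta k) ^ P.d) ((P.L : ℝ) ^ k) (ρ j / 16) (ρ j / 8) j b b₁) x =
        diverg ((P.L : ℝ) ^ k) (fun b : PBond P 0 => hKer (P := P) ((P.eta k) ^ P.d) ((P.L : ℝ) ^ k) j b b₁ -
          hlKer (P := P) ((P.eta k) ^ P.d) ((P.L : ℝ) ^ k) (ρ j / 16) (ρ j / 8) j b b₁) x from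
      (congrFun (diverg_sub ((P.L : ℝ) ^ k) (fun b : PBond P 0 => hKer (P := P) ((P.eta k) ^ P.d) ((P.L : ℝ) ^ k) j b b₁)
        (fun b : PBond P 0 => hlKer (P := P) ((P.eta k) ^ P.d) ((P.L : ℝ) ^ k) (ρ j / 16) (ρ j / 8) j b b₁)) x).symm]
    refine (abs_diverg_hKer_sub_hlKer_le hj hw hc ha hδ.le hH hB hC0 hR hCζ' k x b₁).trans ?_
    have hA2 : 0 ≤ (1 + C / (ρ j / 8 - ρ j / 16)) * Real.exp (δ / 2) * Real.exp (-(δ / 2 * (ρ j / 16))) := by positivity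
    have hAA2 : (1 + C / (ρ j / 8 - ρ j / 16)) * Real.exp (δ / 2) * Real.exp (-(δ / 2 * (ρ j / 16))) ≤
        (1 + 16 * C / ρ₀) * Real.exp (δ / 2) * Real.exp (-(δ / 2 * (ρ j / 16))) :=
      mul_le_mul_of_nonneg_right (mul_le_mul_of_nonneg_right hAA (Real.exp_pos _).le) (Real.exp_pos _).le
    have hE2 : 0 ≤ Real.exp (δ / 2) * Real.exp (-(δ / 2 * distEU P j x b₁.src)) := by positivity
    have h := upgrade (Nat.cast_nonneg P.d) hLk hLji hM hA2 hAA2 hE2 le_rfl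
    have hexpδ : Real.exp δ = Real.exp (δ / 2) * Real.exp (δ / 2) := by rw [← Real.exp_add, add_halves]
    refine (le_of_eq ?_).trans (h.trans (le_of_eq ?_))
    · ring
    · rw [hlam0, ← hkj, hexpδ]; ring
  rw [stT_eq_sum]
  exact abs_leftFace_le hd hk hj hjk ha hδ hδC hM hMC hH hB hC0 hCζ ρ hρ₀ hr hCm hCl hCd hlam0_0 hΛl hΛd p'

/-- **THE SCALE SUM `Σ_{j<k}(∂*T_j)(x, p′)`** (hypotheses as in p02's `abs_sum_tT_le` with the scale gap against `L^{d}`: `L^de^{−c₁θ} ≤ ½`,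
`c₁ = min(δ/32, δ_C/4)`): `|Σ_{j<k}(∂*T_j)(x,p′)| ≤ (2 + (1+16C_σ/ρ₀)e^{δ/2})·2λ₀′MM_Cd²e^{a/2}K(a)²·e^{a/2}·e^{−c₁ρ_k}·e^{−a dist_k(x,p′₋)}`,
`λ₀′ = dM(1+16C_σ/ρ₀)e^{δ}` — the `∂*w′₁` member of «similarly for w′₁, ∂*w′₁».
[cite: BalabanImbrieJaffe1988, (5.4.3) p.282] -/
theorem abs_sum_stT_le (hd : 2 ≤ P.d) {k : ℕ} (hk : k ≤ P.m + P.K) {a : ℝ} (ha : 0 < a)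
    {δ M δC MC : ℝ} (hδ : 0 < δ) (hδC : 0 < δC) (hM : 0 ≤ M) (hMC : 0 ≤ MC)
    (hH : ∀ (j : ℕ) (hj : j ≤ P.m + P.K), j < k → ∀ (μ ν : Fin P.d) (x : TSite P 0) (y : TSite P j),
      |(torusRep P j (deltaAData hj a)).H (x, μ) (y, ν)| ≤ M * Real.exp (-(δ * distEU P j x y)))
    (hB : ∀ (j : ℕ) (hj : j ≤ P.m + P.K), j < k → ∀ (μ ν : Fin P.d) (x : TSite P 0) (y : TSite P j),
      ‖fun lam : Fin P.d => (P.L : ℝ) ^ j *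
          ((torusRep P j (deltaAData hj a)).H (x.shift lam, μ) (y, ν) - (torusRep P j (deltaAData hj a)).H (x, μ) (y, ν))‖ ≤
        M * Real.exp (-(δ * distEU P j x y)))
    {C : ℝ} (hC0 : 0 ≤ C) (hCζ : ∀ (R₁ R₀ : ℝ), R₁ < R₀ → ∀ t s : ℝ,
      |cutoffProfile R₁ R₀ t - cutoffProfile R₁ R₀ s| ≤ C / (R₀ - R₁) * |t - s|)
    (ρ : ℕ → ℝ) {ρ₀ θ : ℝ} (hρ₀ : 0 < ρ₀) (hρ : ∀ j < k, ρ₀ ≤ ρ j)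
    (hgap : ∀ j < k, ρ k + ((k - j : ℕ) : ℝ) * θ ≤ ρ j)
    (hθ : (P.L : ℝ) ^ P.d * Real.exp (-(min (δ / 32) (δC / 4) * θ)) ≤ 1 / 2)
    (hCm : ∀ j < k, ∀ b₁ b₂ : PBond P j, |Cmat P j b₁ b₂| ≤ MC * Real.exp (-(δC * (supDist b₁.src b₂.src : ℝ))))
    (hCl : ∀ j < k, ∀ b₁ b₂ : PBond P j, |Cloc P j (ρ j / 4) b₁ b₂| ≤ MC * Real.exp (-(δC * (supDist b₁.src b₂.src : ℝ))))
    (hCd : ∀ j < k, ∀ b₁ b₂ : PBond P j, |Cloc P j (ρ j / 4) b₁ b₂ - Cmat P j b₁ b₂| ≤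
      MC * Real.exp (-(δC / 4 * ρ j)) * Real.exp (-(δC * (supDist b₁.src b₂.src : ℝ))))
    (x : TSite P 0) (p' : TPlaq P k) :
    |∑ j ∈ Finset.range k, stT hd ρ k j x p'| ≤
      (2 + (1 + 16 * C / ρ₀) * Real.exp (δ / 2)) *
        (2 * ((P.d : ℝ) * (M * (1 + 16 * C / ρ₀)) * Real.exp δ) * M * MC *
          ((P.d : ℝ) ^ 2 * (Real.exp (min (δ / 2) δC / 2 / 2) * ((2 * (1 + P.d / (min (δ / 2) δC / 2))) ^ P.d) ^ 2))) *
        Real.exp (min (δ / 2) δC / 2 / 2) * Real.exp (-(min (δ / 32) (δC / 4) * ρ k)) *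
        Real.exp (-(min (δ / 2) δC / 2 * distEU P k x p'.src)) := by
  set c₁ : ℝ := min (δ / 32) (δC / 4) with hc₁
  have hc₁0 : 0 ≤ c₁ := (lt_min (by positivity) (by positivity)).le
  set S₀ : ℝ := 2 + (1 + 16 * C / ρ₀) * Real.exp (δ / 2) with hS₀
  set Z : ℝ := 2 * ((P.d : ℝ) * (M * (1 + 16 * C / ρ₀)) * Real.exp δ) * M * MC *
    ((P.d : ℝ) ^ 2 * (Real.exp (min (δ / 2) δC / 2 / 2) * ((2 * (1 + P.d / (min (δ / 2) δC / 2))) ^ P.d) ^ 2)) with hZ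
  set E' : ℝ := Real.exp (min (δ / 2) δC / 2 / 2) * Real.exp (-(min (δ / 2) δC / 2 * distEU P k x p'.src)) with hE'
  have hZ0 : 0 ≤ Z := by positivity
  have hE0 : 0 ≤ E' := by positivity
  have hC' : 0 ≤ 1 + 16 * C / ρ₀ := by positivity
  have hj' : ∀ j < k, j ≤ P.m + P.K := fun j hj => by omega
  have hscale : ∀ j ∈ Finset.range k, |stT hd ρ k j x p'| ≤
      (S₀ * Z * E') * (((P.L : ℝ) ^ P.d) ^ (k - j) * Real.exp (-(c₁ * ρ j))) := by
    intro j hjm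
    have hjk := Finset.mem_range.1 hjm
    have h := abs_stT_le hd hk (hj' j hjk) hjk.le ha hδ hδC hM hMC (hH j (hj' j hjk) hjk) (hB j (hj' j hjk) hjk) hC0 hCζ ρ hρ₀
      (hρ j hjk) (hCm j hjk) (hCl j hjk) (hCd j hjk) x p'
    refine h.trans ?_
    have hsm := smallness_weight_le (δ := δ) (δC := δC) hC' ((hρ₀.le).trans (hρ j hjk))
    rw [← hc₁, ← hS₀] at hsm
    rw [← hE']
    have hsplitZ : 2 * ((P.d : ℝ) * (P.L : ℝ) ^ (k - j) * (M * (1 + 16 * C / ρ₀)) * Real.exp δ) * M * MC *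
          ((P.L : ℝ) ^ (k - j)) ^ (P.d - 1) * ((P.d : ℝ) ^ 2 *
          (Real.exp (min (δ / 2) δC / 2 / 2) * ((2 * (1 + P.d / (min (δ / 2) δC / 2))) ^ P.d) ^ 2)) =
        Z * ((P.L : ℝ) ^ P.d) ^ (k - j) := by
      rw [hZ, ← pow_pow_comm_d, ← mul_pow_dm1 hd ((P.L : ℝ) ^ (k - j))]; ring
    rw [hsplitZ]
    have hY : 0 ≤ Z * ((P.L : ℝ) ^ P.d) ^ (k - j) * E' := by positivity
    calc _ ≤ (S₀ * Real.exp (-(c₁ * ρ j))) * (Z * ((P.L : ℝ) ^ P.d) ^ (k - j)) * E' :=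
          mul_le_mul_of_nonneg_right (mul_le_mul_of_nonneg_right hsm (by positivity)) hE0
      _ = _ := by ring
  calc |∑ j ∈ Finset.range k, stT hd ρ k j x p'| ≤ ∑ j ∈ Finset.range k, |stT hd ρ k j x p'| := Finset.abs_sum_le_sum_abs _ _
    _ ≤ ∑ j ∈ Finset.range k, (S₀ * Z * E') * (((P.L : ℝ) ^ P.d) ^ (k - j) * Real.exp (-(c₁ * ρ j))) :=
        Finset.sum_le_sum hscale
    _ = (S₀ * Z * E') * ∑ j ∈ Finset.range k, ((P.L : ℝ) ^ P.d) ^ (k - j) * Real.exp (-(c₁ * ρ j)) := by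
        rw [Finset.mul_sum]
    _ ≤ (S₀ * Z * E') * Real.exp (-(c₁ * ρ k)) :=
        mul_le_mul_of_nonneg_left (sum_pow_smallness_le (pow_pos P.cast_L_pos _).le hc₁0 hθ hgap) (by positivity)
    _ = _ := by rw [hE']; ring

/-- **THE BOUND FOR `(∂*w′₁)(x, b′)` ON THE TORUS** (hypotheses of `abs_sum_stT_le`, a cube function `|χ| ≤ 1`): for every fine site `x`
and unit bond `b′`, `|(∂*w′₁)(x, b′)| ≤ 4d·(2 + (1+16C_σ/ρ₀)e^{δ/2})·2λ₀′MM_Cd²e^{a/2}K(a)²·e^{a/2}·e^{a}·e^{−c₁ρ_k}·e^{−a·dist_k(x, b′₋)}`,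
`λ₀′ = dM(1+16C_σ/ρ₀)e^{δ}` — the reduction `sw1P_eq_sum`, the scale sum `abs_sum_stT_le` at each of the `≤ 4d` unit plaquettes through `b′`
(p02's `sum_abs_curl_boxSingle_mul_le`, `distEU_coarse_shift_le`). [cite: BalabanImbrieJaffe1988, (5.4.3) p.282] -/
theorem abs_sw1P_le (hd : 2 ≤ P.d) {k : ℕ} (hk : k ≤ P.m + P.K) {a : ℝ} (ha : 0 < a)
    {δ M δC MC : ℝ} (hδ : 0 < δ) (hδC : 0 < δC) (hM : 0 ≤ M) (hMC : 0 ≤ MC)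
    (hH : ∀ (j : ℕ) (hj : j ≤ P.m + P.K), j < k → ∀ (μ ν : Fin P.d) (x : TSite P 0) (y : TSite P j),
      |(torusRep P j (deltaAData hj a)).H (x, μ) (y, ν)| ≤ M * Real.exp (-(δ * distEU P j x y)))
    (hB : ∀ (j : ℕ) (hj : j ≤ P.m + P.K), j < k → ∀ (μ ν : Fin P.d) (x : TSite P 0) (y : TSite P j),
      ‖fun lam : Fin P.d => (P.L : ℝ) ^ j *
          ((torusRep P j (deltaAData hj a)).H (x.shift lam, μ) (y, ν) - (torusRep P j (deltaAData hj a)).H (x, μ) (y, ν))‖ ≤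
        M * Real.exp (-(δ * distEU P j x y)))
    {C : ℝ} (hC0 : 0 ≤ C) (hCζ : ∀ (R₁ R₀ : ℝ), R₁ < R₀ → ∀ t s : ℝ,
      |cutoffProfile R₁ R₀ t - cutoffProfile R₁ R₀ s| ≤ C / (R₀ - R₁) * |t - s|)
    (ρ : ℕ → ℝ) {ρ₀ θ : ℝ} (hρ₀ : 0 < ρ₀) (hρ : ∀ j < k, ρ₀ ≤ ρ j)
    (hgap : ∀ j < k, ρ k + ((k - j : ℕ) : ℝ) * θ ≤ ρ j)
    (hθ : (P.L : ℝ) ^ P.d * Real.exp (-(min (δ / 32) (δC / 4) * θ)) ≤ 1 / 2)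
    (hCm : ∀ j < k, ∀ b₁ b₂ : PBond P j, |Cmat P j b₁ b₂| ≤ MC * Real.exp (-(δC * (supDist b₁.src b₂.src : ℝ))))
    (hCl : ∀ j < k, ∀ b₁ b₂ : PBond P j, |Cloc P j (ρ j / 4) b₁ b₂| ≤ MC * Real.exp (-(δC * (supDist b₁.src b₂.src : ℝ))))
    (hCd : ∀ j < k, ∀ b₁ b₂ : PBond P j, |Cloc P j (ρ j / 4) b₁ b₂ - Cmat P j b₁ b₂| ≤
      MC * Real.exp (-(δC / 4 * ρ j)) * Real.exp (-(δC * (supDist b₁.src b₂.src : ℝ))))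
    (χ : PBond P k → ℝ) (hχ : ∀ b', |χ b'| ≤ 1) (x : TSite P 0) (b' : PBond P k) :
    |sw1P hd ρ k χ x b'| ≤
      4 * P.d * ((2 + (1 + 16 * C / ρ₀) * Real.exp (δ / 2)) *
        (2 * ((P.d : ℝ) * (M * (1 + 16 * C / ρ₀)) * Real.exp δ) * M * MC *
          ((P.d : ℝ) ^ 2 * (Real.exp (min (δ / 2) δC / 2 / 2) * ((2 * (1 + P.d / (min (δ / 2) δC / 2))) ^ P.d) ^ 2))) *
        Real.exp (min (δ / 2) δC / 2 / 2) * Real.exp (min (δ / 2) δC / 2)) * Real.exp (-(min (δ / 32) (δC / 4) * ρ k)) *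
        Real.exp (-(min (δ / 2) δC / 2 * distEU P k x b'.src)) := by
  set aa : ℝ := min (δ / 2) δC / 2 with haa
  have haa0 : 0 < aa := half_pos (lt_min (half_pos hδ) hδC)
  set Y : ℝ := (2 + (1 + 16 * C / ρ₀) * Real.exp (δ / 2)) *
      (2 * ((P.d : ℝ) * (M * (1 + 16 * C / ρ₀)) * Real.exp δ) * M * MC * ((P.d : ℝ) ^ 2 * (Real.exp (aa / 2) * ((2 * (1 + P.d / aa)) ^ P.d) ^ 2))) *
      Real.exp (aa / 2) * Real.exp (-(min (δ / 32) (δC / 4) * ρ k)) with hY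
  have hY0 : 0 ≤ Y := by positivity
  clear_value Y
  have hsum : ∀ p' : TPlaq P k, |∑ j ∈ Finset.range k, stT hd ρ k j x p'| ≤ Y * Real.exp (-(aa * distEU P k x p'.src)) := by
    intro p'
    have h := abs_sum_stT_le hd hk ha hδ hδC hM hMC hH hB hC0 hCζ ρ hρ₀ hρ hgap hθ hCm hCl hCd x p'
    rw [← haa] at h
    refine h.trans (le_of_eq ?_)
    rw [hY]
  have hnear : ∀ p' : TPlaq P k, distEU P k x b'.src ≤ distEU P k x p'.src + 1 →
      |∑ j ∈ Finset.range k, stT hd ρ k j x p'| ≤ Y * Real.exp aa * Real.exp (-(aa * distEU P k x b'.src)) := by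
    intro p' hp'
    refine (hsum p').trans ?_
    have hexp : Real.exp (-(aa * distEU P k x p'.src)) ≤ Real.exp aa * Real.exp (-(aa * distEU P k x b'.src)) := by
      rw [← Real.exp_add]; exact Real.exp_le_exp.2 (by nlinarith)
    calc Y * Real.exp (-(aa * distEU P k x p'.src)) ≤ Y * (Real.exp aa * Real.exp (-(aa * distEU P k x b'.src))) :=
        mul_le_mul_of_nonneg_left hexp hY0
      _ = _ := (mul_assoc _ _ _).symm
  have hW1 : ∀ p' : TPlaq P k, (⟨p'.src, p'.μ⟩ : PBond P k) = b' →
      |∑ j ∈ Finset.range k, stT hd ρ k j x p'| ≤ Y * Real.exp aa * Real.exp (-(aa * distEU P k x b'.src)) := by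
    intro p' h; refine hnear p' ?_; rw [← h]; linarith
  have hW2 : ∀ p' : TPlaq P k, (⟨p'.src.shift p'.μ, p'.ν⟩ : PBond P k) = b' →
      |∑ j ∈ Finset.range k, stT hd ρ k j x p'| ≤ Y * Real.exp aa * Real.exp (-(aa * distEU P k x b'.src)) := by
    intro p' h; refine hnear p' ?_; rw [← h]; exact distEU_coarse_shift_le hk x p'.src p'.μ
  have hW3 : ∀ p' : TPlaq P k, (⟨p'.src.shift p'.ν, p'.μ⟩ : PBond P k) = b' →
      |∑ j ∈ Finset.range k, stT hd ρ k j x p'| ≤ Y * Real.exp aa * Real.exp (-(aa * distEU P k x b'.src)) := by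
    intro p' h; refine hnear p' ?_; rw [← h]; exact distEU_coarse_shift_le hk x p'.src p'.ν
  have hW4 : ∀ p' : TPlaq P k, (⟨p'.src, p'.ν⟩ : PBond P k) = b' →
      |∑ j ∈ Finset.range k, stT hd ρ k j x p'| ≤ Y * Real.exp aa * Real.exp (-(aa * distEU P k x b'.src)) := by
    intro p' h; refine hnear p' ?_; rw [← h]; linarith
  have hmain := sum_abs_curl_boxSingle_mul_le χ b' (w := fun p' => |∑ j ∈ Finset.range k, stT hd ρ k j x p'|)
    (fun p' => abs_nonneg _) (by positivity) hW1 hW2 hW3 hW4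
  refine (abs_sw1P_le_sum hd ρ χ x b').trans (hmain.trans ?_)
  have hχ1 := hχ b'
  have hpos : 0 ≤ 4 * (P.d : ℝ) * (Y * Real.exp aa * Real.exp (-(aa * distEU P k x b'.src))) := by positivity
  calc 4 * P.d * |χ b'| * (Y * Real.exp aa * Real.exp (-(aa * distEU P k x b'.src)))
      ≤ 4 * P.d * 1 * (Y * Real.exp aa * Real.exp (-(aa * distEU P k x b'.src))) := by nlinarith
    _ = _ := by rw [hY]; ring

/-- **(5.4.7)-SHAPE FOR `∂*w′₁` ON EVERY TORUS OF THE SERIES, FOR THE KERNELS OF RECORD — NO HYPOTHESIS** (`d ≥ 2`; per-tower [6I] Prop. 1.2 is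
p16's theorem, p09's `cloc_estimates`, this seat's profile slope; `a = 1`): there are `c, θ₀, ρ₁ > 0` such that for every `k ≤ m + K`, every
radius schedule with `ρ_k ≥ ρ₁` and the scale gap `ρ_j ≥ ρ_k + (k−j)θ₀` (`j < k`), and every cube function `|χ| ≤ 1`:
`Ineq547 (T_η-sites) (T₁^{(k)}-bonds) ∂*w′₁ dist_k c ρ_k`, i.e. **`|(∂*w′₁)(x, b′)| ≤ e^{−cρ_k}e^{−c·dist_k(x, b′₋)}` for all `x, b′`** —
the printed «and similarly for … ∂*w′₁». [cite: BalabanImbrieJaffe1988, (5.4.3) p.282] -/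
theorem ineq547_sw1P_torus (hd : 2 ≤ P.d) :
    ∃ c θ₀ ρ₁ : ℝ, 0 < c ∧ 0 < θ₀ ∧ 0 < ρ₁ ∧ ∀ (k : ℕ) (_ : k ≤ P.m + P.K) (ρ : ℕ → ℝ),
      ρ₁ ≤ ρ k → (∀ j < k, ρ k + ((k - j : ℕ) : ℝ) * θ₀ ≤ ρ j) →
      ∀ (χ : PBond P k → ℝ), (∀ b', |χ b'| ≤ 1) →
        Ineq547 (TSite P 0) (PBond P k) (sw1P hd ρ k χ) (fun x b' => distEU P k x b'.src) c (ρ k) := by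
  classical
  have h722 := ineq722_deltaA_of_prop12Printed (levStd P) levStd_le one_pos (fun _ => PUnit) (fun _ _ _ => 0) (fun _ _ _ _ _ => 0)
    (fun _ _ _ => 0) (prop12Printed_levStd_deltaA P 1)
  obtain ⟨δ, M, hδ, hM, hBall⟩ := exists_bound_of_ineq722 levStd_le h722
  obtain ⟨MC, δ₀, hMC, hδ₀, HC⟩ := cloc_estimates P.d P.L hd
  obtain ⟨C, hC0, hCζ⟩ := exists_cutoffProfile_lipschitz
  have hcov : ∀ j ≤ P.m + P.K, ∃ i, levStd P i = j := fun j hj => ⟨j, min_eq_left hj⟩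
  have hδC : 0 < δ₀ / 2 := half_pos hδ₀
  set MC' : ℝ := MC * (Real.exp (4 * δ₀ * P.L) * (1 + P.L) ^ 2) with hMC'
  have hMC'0 : 0 ≤ MC' := by positivity
  set c₁ : ℝ := min (δ / 32) (δ₀ / 2 / 4) with hc₁
  have hc₁0 : 0 < c₁ := lt_min (by positivity) (by positivity)
  set aa : ℝ := min (δ / 2) (δ₀ / 2) / 2 with haa
  have haa0 : 0 < aa := half_pos (lt_min (half_pos hδ) hδC)
  set Λ : ℝ := (P.L : ℝ) ^ P.d with hΛ
  have hΛ0 : 0 < Λ := pow_pos P.cast_L_pos _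
  set θ₀ : ℝ := Real.log (2 * Λ) / c₁ with hθ₀
  have hθ₀0 : 0 < θ₀ := by
    refine div_pos (Real.log_pos ?_) hc₁0
    have : (1 : ℝ) ≤ Λ := one_le_pow₀ (by exact_mod_cast P.L_pos)
    linarith
  set A : ℝ := 4 * P.d * ((2 + (1 + 16 * C / 1) * Real.exp (δ / 2)) *
      (2 * ((P.d : ℝ) * (M * (1 + 16 * C / 1)) * Real.exp δ) * M * MC' * ((P.d : ℝ) ^ 2 * (Real.exp (aa / 2) * ((2 * (1 + P.d / aa)) ^ P.d) ^ 2))) *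
      Real.exp (aa / 2) * Real.exp aa) with hA
  set ρ₁ : ℝ := max 1 (2 * Real.log (max A 1) / c₁) with hρ₁
  have hρ₁1 : 1 ≤ ρ₁ := le_max_left _ _
  refine ⟨min aa (c₁ / 2), θ₀, ρ₁, lt_min haa0 (half_pos hc₁0), hθ₀0, lt_of_lt_of_le one_pos hρ₁1,
    fun k hk ρ hρk hgap χ hχ => ?_⟩
  have hH : ∀ (j : ℕ) (hj : j ≤ P.m + P.K), j < k → ∀ (μ ν : Fin P.d) (x : TSite P 0) (y : TSite P j),
      |(torusRep P j (deltaAData hj 1)).H (x, μ) (y, ν)| ≤ M * Real.exp (-(δ * distEU P j x y)) := by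
    intro j hj _ μ ν x y
    obtain ⟨i, hi⟩ := hcov j hj
    subst hi
    exact (le_add_of_nonneg_right torusKernelData_gradH_nonneg).trans (hBall i μ ν x y)
  have hB : ∀ (j : ℕ) (hj : j ≤ P.m + P.K), j < k → ∀ (μ ν : Fin P.d) (x : TSite P 0) (y : TSite P j),
      ‖fun lam : Fin P.d => (P.L : ℝ) ^ j *
          ((torusRep P j (deltaAData hj 1)).H (x.shift lam, μ) (y, ν) - (torusRep P j (deltaAData hj 1)).H (x, μ) (y, ν))‖ ≤
        M * Real.exp (-(δ * distEU P j x y)) := by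
    intro j hj _ μ ν x y
    obtain ⟨i, hi⟩ := hcov j hj
    subst hi
    have h := hBall i μ ν x y
    rw [torusKernelData_gradH] at h
    exact (le_add_of_nonneg_left (abs_nonneg _)).trans h
  have hC : ∀ j < k, (∀ b₁ b₂ : PBond P j, |Cmat P j b₁ b₂| ≤ MC' * Real.exp (-(δ₀ / 2 * (supDist b₁.src b₂.src : ℝ)))) ∧
      (∀ b₁ b₂ : PBond P j, |Cloc P j (ρ j / 4) b₁ b₂| ≤ MC' * Real.exp (-(δ₀ / 2 * (supDist b₁.src b₂.src : ℝ)))) ∧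
      (∀ b₁ b₂ : PBond P j, |Cloc P j (ρ j / 4) b₁ b₂ - Cmat P j b₁ b₂| ≤
        MC' * Real.exp (-(δ₀ / 2 / 4 * ρ j)) * Real.exp (-(δ₀ / 2 * (supDist b₁.src b₂.src : ℝ)))) :=
    fun j hjk => cSide_of_cloc_estimates hMC hδ₀ (fun R b b' => HC P rfl rfl j inferInstance (by omega) R b b') (ρ j)
  have hρk0 : 0 ≤ ρ k := by linarith
  have hρ : ∀ j < k, (1 : ℝ) ≤ ρ j := by
    intro j hj
    have h := hgap j hj
    have : 0 ≤ ((k - j : ℕ) : ℝ) * θ₀ := mul_nonneg (Nat.cast_nonneg _) hθ₀0.le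
    linarith
  have hθ : Λ * Real.exp (-(c₁ * θ₀)) ≤ 1 / 2 := (gap_threshold_eq hΛ0 hc₁0).le
  intro x b'
  have hw := abs_sw1P_le hd hk one_pos hδ hδC hM hMC'0 hH hB hC0 hCζ ρ one_pos hρ hgap hθ
    (fun j hjk => (hC j hjk).1) (fun j hjk => (hC j hjk).2.1) (fun j hjk => (hC j hjk).2.2) χ hχ x b'
  have hD : 0 ≤ distEU P k x b'.src := div_nonneg (Nat.cast_nonneg _) (cast_pow_L_pos' k).le
  have hρA : 2 * Real.log (max A 1) / c₁ ≤ ρ k := (le_max_right _ _).trans hρk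
  exact hw.trans (absorb_prefactor hc₁0 hD hρA hρk0)

/-- **(5.4.7)-SHAPE FOR `∂*w′₁` OVER ALL TORI FROM [6I] PROP. 1.2 BY ITS TREE NAME** (`2 ≤ d`, `L` odd `> 1`): ONE `(c, θ₀, ρ₁)` for EVERY torus
(`P.d = d`, `P.L = L`), every `k ≤ m + K`, every admissible schedule and cube function (this seat's all-tori sup + gradient lemma
`exists_HB_allTori_of_prop12Printed`, p09's all-tori `cloc_estimates`). [cite: BalabanImbrieJaffe1988, (5.4.3) p.282] -/
theorem ineq547_sw1P_allTori_of_prop12Printed {d L : ℕ} (hd : 2 ≤ d) (hL : Odd L ∧ 1 < L) {a : ℝ} (ha : 0 < a)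
    (h12 : B5.Prop12Printed (fun i : {x : Params × ℕ // x.1.d = d ∧ x.1.L = L ∧ 1 ≤ x.2 ∧ x.2 ≤ x.1.m + x.1.K} =>
      settingOf (torusRep i.1.1 i.1.2 (deltaAData i.2.2.2.2 a)) i.1.2)) :
    ∃ c θ₀ ρ₁ : ℝ, 0 < c ∧ 0 < θ₀ ∧ 0 < ρ₁ ∧ ∀ (P : Params) (hPd : P.d = d) (_ : P.L = L) (k : ℕ) (_ : k ≤ P.m + P.K) (ρ : ℕ → ℝ),
      ρ₁ ≤ ρ k → (∀ j < k, ρ k + ((k - j : ℕ) : ℝ) * θ₀ ≤ ρ j) →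
      ∀ (χ : PBond P k → ℝ), (∀ b', |χ b'| ≤ 1) →
        Ineq547 (TSite P 0) (PBond P k) (sw1P (hPd ▸ hd) ρ k χ) (fun x b' => distEU P k x b'.src) c (ρ k) := by
  classical
  obtain ⟨δ, M, hδ, hM1, hHB⟩ := exists_HB_allTori_of_prop12Printed (le_trans one_le_two hd) hL ha h12
  obtain ⟨MC, δ₀, hMC, hδ₀, HC⟩ := cloc_estimates d L hd
  obtain ⟨C, hC0, hCζ⟩ := exists_cutoffProfile_lipschitz
  have hδC : 0 < δ₀ / 2 := half_pos hδ₀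
  have hM : 0 ≤ M := zero_le_one.trans hM1
  have hL0 : (0 : ℝ) < L := by have := hL.2; exact_mod_cast (by omega : 0 < L)
  set MC' : ℝ := MC * (Real.exp (4 * δ₀ * L) * (1 + L) ^ 2) with hMC'
  have hMC'0 : 0 ≤ MC' := by positivity
  set c₁ : ℝ := min (δ / 32) (δ₀ / 2 / 4) with hc₁
  have hc₁0 : 0 < c₁ := lt_min (by positivity) (by positivity)
  set aa : ℝ := min (δ / 2) (δ₀ / 2) / 2 with haa
  have haa0 : 0 < aa := half_pos (lt_min (half_pos hδ) hδC)
  set Λ : ℝ := (L : ℝ) ^ d with hΛ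
  have hΛ0 : 0 < Λ := pow_pos hL0 _
  set θ₀ : ℝ := Real.log (2 * Λ) / c₁ with hθ₀
  have hθ₀0 : 0 < θ₀ := by
    refine div_pos (Real.log_pos ?_) hc₁0
    have : (1 : ℝ) ≤ Λ := one_le_pow₀ (by have := hL.2; exact_mod_cast (by omega : 1 ≤ L))
    linarith
  set A : ℝ := 4 * d * ((2 + (1 + 16 * C / 1) * Real.exp (δ / 2)) *
      (2 * ((d : ℝ) * (M * (1 + 16 * C / 1)) * Real.exp δ) * M * MC' * ((d : ℝ) ^ 2 * (Real.exp (aa / 2) * ((2 * (1 + d / aa)) ^ d) ^ 2))) *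
      Real.exp (aa / 2) * Real.exp aa) with hA
  set ρ₁ : ℝ := max 1 (2 * Real.log (max A 1) / c₁) with hρ₁
  have hρ₁1 : 1 ≤ ρ₁ := le_max_left _ _
  refine ⟨min aa (c₁ / 2), θ₀, ρ₁, lt_min haa0 (half_pos hc₁0), hθ₀0, lt_of_lt_of_le one_pos hρ₁1,
    fun P hPd hPL k hk ρ hρk hgap χ hχ => ?_⟩
  subst hPd; subst hPL
  have hH : ∀ (j : ℕ) (hj : j ≤ P.m + P.K), j < k → ∀ (μ ν : Fin P.d) (x : TSite P 0) (y : TSite P j),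
      |(torusRep P j (deltaAData hj a)).H (x, μ) (y, ν)| ≤ M * Real.exp (-(δ * distEU P j x y)) :=
    fun j hj _ μ ν x y => (hHB P rfl rfl j hj μ ν x y).1
  have hB : ∀ (j : ℕ) (hj : j ≤ P.m + P.K), j < k → ∀ (μ ν : Fin P.d) (x : TSite P 0) (y : TSite P j),
      ‖fun lam : Fin P.d => (P.L : ℝ) ^ j *
          ((torusRep P j (deltaAData hj a)).H (x.shift lam, μ) (y, ν) - (torusRep P j (deltaAData hj a)).H (x, μ) (y, ν))‖ ≤
        M * Real.exp (-(δ * distEU P j x y)) :=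
    fun j hj _ μ ν x y => (hHB P rfl rfl j hj μ ν x y).2
  have hC : ∀ j < k, (∀ b₁ b₂ : PBond P j, |Cmat P j b₁ b₂| ≤ MC' * Real.exp (-(δ₀ / 2 * (supDist b₁.src b₂.src : ℝ)))) ∧
      (∀ b₁ b₂ : PBond P j, |Cloc P j (ρ j / 4) b₁ b₂| ≤ MC' * Real.exp (-(δ₀ / 2 * (supDist b₁.src b₂.src : ℝ)))) ∧
      (∀ b₁ b₂ : PBond P j, |Cloc P j (ρ j / 4) b₁ b₂ - Cmat P j b₁ b₂| ≤
        MC' * Real.exp (-(δ₀ / 2 / 4 * ρ j)) * Real.exp (-(δ₀ / 2 * (supDist b₁.src b₂.src : ℝ)))) :=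
    fun j hjk => cSide_of_cloc_estimates hMC hδ₀ (fun R b b' => HC P rfl rfl j inferInstance (by omega) R b b') (ρ j)
  have hρk0 : 0 ≤ ρ k := by linarith
  have hρ : ∀ j < k, (1 : ℝ) ≤ ρ j := by
    intro j hj
    have h := hgap j hj
    have : 0 ≤ ((k - j : ℕ) : ℝ) * θ₀ := mul_nonneg (Nat.cast_nonneg _) hθ₀0.le
    linarith
  have hθ : Λ * Real.exp (-(c₁ * θ₀)) ≤ 1 / 2 := (gap_threshold_eq hΛ0 hc₁0).le
  intro x b'
  have hw := abs_sw1P_le hd hk ha hδ hδC hM hMC'0 hH hB hC0 hCζ ρ one_pos hρ hgap hθ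
    (fun j hjk => (hC j hjk).1) (fun j hjk => (hC j hjk).2.1) (fun j hjk => (hC j hjk).2.2) χ hχ x b'
  have hD : 0 ≤ distEU P k x b'.src := div_nonneg (Nat.cast_nonneg _) (cast_pow_L_pos' k).le
  have hρA : 2 * Real.log (max A 1) / c₁ ≤ ρ k := (le_max_right _ _).trans hρk
  exact hw.trans (absorb_prefactor hc₁0 hD hρA hρk0)

/-- **(5.4.7)-SHAPE FOR `∂*w′₁` OVER ALL TORI, HYPOTHESIS-FREE** (`2 ≤ d`, `L` odd `> 1`): ONE `(c, θ₀, ρ₁)` for every torus, every `k ≤ m + K`,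
every admissible schedule and cube function — with [6I] Prop. 1.2 supplied by p19's `prop12Printed_allTori` (at `a = 1`).
[cite: BalabanImbrieJaffe1988, (5.4.3) p.282] -/
theorem ineq547_sw1P_allTori {d L : ℕ} (hd : 2 ≤ d) (hL : Odd L ∧ 1 < L) :
    ∃ c θ₀ ρ₁ : ℝ, 0 < c ∧ 0 < θ₀ ∧ 0 < ρ₁ ∧ ∀ (P : Params) (hPd : P.d = d) (_ : P.L = L) (k : ℕ) (_ : k ≤ P.m + P.K) (ρ : ℕ → ℝ),
      ρ₁ ≤ ρ k → (∀ j < k, ρ k + ((k - j : ℕ) : ℝ) * θ₀ ≤ ρ j) →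
      ∀ (χ : PBond P k → ℝ), (∀ b', |χ b'| ≤ 1) →
        Ineq547 (TSite P 0) (PBond P k) (sw1P (hPd ▸ hd) ρ k χ) (fun x b' => distEU P k x b'.src) c (ρ k) :=
  ineq547_sw1P_allTori_of_prop12Printed hd hL one_pos (prop12Printed_allTori d L one_pos)

end Div

end

end Literature.MathematicalPhysics.QuantumFieldTheory.BalabanImbrieJaffe1984to88.BIJ88W1Prime543CurlBoundTorus
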